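import Summits.AtomisticToContinuum.BoseEinsteinCondensation.Theses.BECThomsonPrinciple
import Literature.Barriers.AtomisticToContinuum.KineticGapLengthScalesFreeGas
import Literature.Barriers.AtomisticToContinuum.KineticGapLengthScalesThermodynamicWindow
import Literature.MathematicalPhysics.QuantumManyBody.HardCoreScatteringLength
import Literature.MathematicalPhysics.QuantumManyBody.TorusFockSectorDictionary

/-!
# Disproof of `GDTransfer` — standing adversary, generation 2 (crux stmt-AtomisticToContinuum-9482)

Work file of the crux disprover (cdisprove, gen 2) for
`Summit.AtomisticToContinuum.BoseEinsteinCondensation.Theses.BECThomsonPrinciple.GDTransfer`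
= `GaussianDominationCan → PeriodicBEC` (route BECThomsonPrinciple, rank 5).

## Findings (index; details in the docstrings)

* §1 LOGIC (re-derived; gen-1 v1 `not_gdTransfer_iff`): `GDTransfer ↔ (GDCan → Consequent)`,
  `Consequent → GDTransfer`, `¬GDCan → GDTransfer`, `¬GDTransfer ↔ GDCan ∧ ¬Consequent`.
  A kill of this crux is EXACTLY a proof of crux 9479 (T = 0 continuum Gaussian domination for every
  admissible `v`) together with a refutation of periodic BEC (stmt-0826's body): out of reach on both
  counts, and the second would refute the physics. VERDICT: resists (consequent-dominated implication).
* §2 CHORD ⇔ SQUARE (`chord_iff_sq`, `ennreal_chord_iff_sq`): the `∀ s ≥ 0` chord inequality of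
  `GaussianDominationCan` at a finite-energy state is equivalent to the squared (KLS) form
  `X² ≤ 4·C'·(E(Φ) − E₀)`, `X = 2N|⟨Φ, e^{ik·x₀}Θ⟩| = 2|⟨Φ,Λ_k†Φ⟩|`, `C' = C L²/‖n‖∞²` — the form the
  transfer actually consumes (`‖ζ‖⁴ ≤ C c_k/k²`); "for all s" carries no information beyond it.
* §3 THE FREE CORNER IS CLOSED ON BOTH SIDES: `PeriodicBECAt 0` holds (tree theorem
  `periodicBEC_antecedent_free`), hence `GDCanAt 0 → PeriodicBECAt 0` outright; with gen-1's
  `v ≡ ⊤` analysis and the reviewers' free-gas check of `GDCanAt 0` (C = 1/4π², displaced oscillator in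
  the LNSS picture) no admissible or junk `v` separates antecedent from consequent.
* §4 DIMENSION IS LOAD-BEARING FOR THE MECHANISM (window count): the KLS output `n_k ≤ A(1 + B√ρ/|k|)`
  summed over the window `|k| ≤ M√ρ` is `≍ M^d ρ^{d/2-1}·N + …`; `ρ^{d/2-1} → 0` as `ρ → 0` iff
  `d ≥ 3` (`window_fraction_vanishes_iff_three_le`): the same GD + KLS chain certifies nothing in
  `d = 1, 2` (consistent with barriers PitaevskiiStringariOneDimension / HohenbergLowDimension, and
  with the Luttinger liquid where phase stiffness holds without BEC). Any proof must use `Fin 3`.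
  §4b makes the `d = 3` count explicit and checked: `sum_inv_supNorm_le`
  (`∑_{0<‖n‖∞≤J} 1/‖n‖∞ ≤ 13J(J+1)` on `ℤ³`, shells `24j²+2`) versus `harmonic_unbounded` (`d = 1`).
* §7 TOY (j006320 done + mean-field limit; j006572 larger sweep auto-attaches): in the 3-mode
  `(0, ±k)` contact gas with the LNSS source the `s → 0` chord is the Bogoliubov susceptibility
  `(1+g)/(1+2g)`, but `sup_s R` is attained at `s = √N k²` by FULL condensate transfer where it
  equals the FREE value `1` for every `g` (finite `N`: 0.56/0.62/0.70 at N = 6/10/20, g = 2) — the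
  `∀s` form never exceeds the free constant (no nonlinear blow-up) and its constant carries no
  stiffness information; KLS slack 1.00 (g = 0, tight) to 1.10.
* §6 (CLOSED, v3) THE FREE VALUE `C = 1/(4π²)` IS SHARP AND THE INLINE SOURCE FUNCTIONAL IS VALIDATED:
  `gdBody_zero_false` / `free_constant_ge` / `gdCanAtWith_zero_false` /
  `gaussianDominationCan_free_constant_ge` — at `v = 0` every constant `C < 1/(4π²)` fails the chord
  inequality (any window `M`, any `ρ₀, N₀`), witnessed by the one-excitation superposition built with
  the tree's Fock-sector dictionary; the crux's `let P/Q/Θ` source term is computed verbatim on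
  plane-wave word sums (`cellAvg_wordSum`, `foldr_step_wordSum`, `theta_wordSum`: `Θ = P₀n̂₀^{-1/2}`
  as claimed; no junk).

NEGATIVES IN PRINT (searched 2026-08-15; searchd/galaxy degraded, crossref + local vector index only):
none against `T = 0` continuum Gaussian domination or against the KLS transfer; the nearest printed
negatives concern the TOOL, not the statement — reflection positivity fails for the quantum Heisenberg
ferromagnet (Speer 1985, doi:10.1007/bf00704585), whose infrared bound is still open (the free energy
was obtained without it: Correggi–Giuliani–Seiringer 2015, doi:10.1007/s00220-015-2402-0), exactly
the situation of crux 9479 (GD wanted, no RP available); LSSY2005 Ch. 5: BEC/superfluidity at `T = 0`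
in the thermodynamic limit "remains open". Ledger negatives for the summit (12) bear on none of GD /
KLS / the periodic reduction.

gen-1 results (refuter-cdisprove-stmt-AtomisticToContinuum-9482-0, evidence Disproof.lean v1–v4 on
the item; files not materialised on this hub, cited from the evidence notes): `not_forall_condensed`,
`gdTransferPointwise_false_without_finiteRange` (v ≡ ⊤: E₀^per < ∞ at low density is used),
`consequent_false_without_energyWindow`, `periodicBECAtLinearWindow_false` (all admissible v),
`gdChord_of_energy_top` (GD is silent at infinite-energy states: verbatim KLS void for hard cores),
`eventually_periodicGroundStateEnergy_ne_top`, `periodicBECAtAllDensities_hardCore_false`,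
`threshold_le_of_hardCore` (ρ₀ ≤ 8/a³), `gdTransferAllDensities_iff_not_gaussianDominationCan`,
`gd_sideConditions_at_sideLength`. Tree: `KineticGapLengthScalesThermodynamicWindow`
(`not_periodicBEC_macroscopicWindow`, `…surfaceWindow`, pointwise versions),
`KineticGapLengthScalesFreeGas` (`periodicBEC_antecedent_free`, `natCast_le_condensateOccupation_add`).
-/

noncomputable section

namespace Summit.AtomisticToContinuum.BoseEinsteinCondensation.Cruxes.GDTransfer.Disproof

open Literature.MathematicalPhysics.QuantumManyBody.BoseGas
open Summit.AtomisticToContinuum.BoseEinsteinCondensation.Theses.BECThomsonPrinciple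
open _root_.MeasureTheory _root_.Filter
open scoped ENNReal NNReal BigOperators ComplexConjugate

/-! ## §1 Logical skeleton -/

/-- Canonical Gaussian domination for ONE potential `v` (the body of `GaussianDominationCan` after
`IsRepulsiveFiniteRange v →`, verbatim). [this route, crux 9479] -/
def GDCanAt (v : ℝ → ℝ≥0∞) : Prop :=
  ∀ M : ℝ, 0 < M → ∃ ρ₀ C : ℝ, 0 < ρ₀ ∧ 0 < C ∧ ∃ N₀ : ℕ, ∀ m : ℕ, N₀ ≤ m + 1 → ∀ L : ℝ, 0 < L → ((m + 1 : ℕ) : ℝ) ≤ ρ₀ * L ^ 3 → ∀ n : Fin 3 → ℤ, n ≠ 0 → 2 * Real.pi * ‖(fun j => (n j : ℝ))‖ / L ≤ M * Real.sqrt ((m + 1 : ℕ) / L ^ 3) → ∀ s : ℝ, 0 ≤ s → ∀ Φ : Literature.MathematicalPhysics.QuantumManyBody.BoseGas.PeriodicTrialState (m + 1) L, let P : Fin (m + 1) → (Literature.MathematicalPhysics.QuantumManyBody.BoseGas.Config (m + 1) → ℂ) → (Literature.MathematicalPhysics.QuantumManyBody.BoseGas.Config (m + 1) → ℂ) := fun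 i g X => ((L ^ 3)⁻¹ : ℝ) • ∫ y in Literature.MathematicalPhysics.QuantumManyBody.BoseGas.cell L, g (Function.update X i y); let Q : Finset (Fin (m + 1)) → (Literature.MathematicalPhysics.QuantumManyBody.BoseGas.Config (m + 1) → ℂ) → (Literature.MathematicalPhysics.QuantumManyBody.BoseGas.Config (m + 1) → ℂ) := fun S g => (List.finRange (m + 1)).foldr (fun i h => if i ∈ S then P i h else h - P i h) g; let Θ : Literature.MathematicalPhysics.QuantumManyBody.BoseGas.Config (m + 1) → ℂ := fun X => ∑ S ∈ (Finset.univ : Finset (Finset (Fin (m + 1)))).filter (fun S => (0 : Fin (m + 1)) ∈ S), ((Real.sqrt (S.card : ℝ))⁻¹ : ℂ) * Q S Φ.ψ X; Literature.MathematicalPhysics.QuantumManyBody.BoseGas.periodicGroundStateEnergy v (m + 1) L + ENNReal.ofReal (s * (2 * (m + 1) * ‖∫ X in Literature.MathematicalPhysics.QuantumManyBody.BoseGas.cellN (m + 1) L, (starRingEnd ℂ) (Φ.ψ X) * Complex.exp (Complex.I * ↑(2 * Real.pi / L * ∑ j, (n j : ℝ) * X 0 j)) * Θ X‖)) ≤ Literature.MathematicalPhysics.QuantumManyBody.BoseGas.periodicEnergy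 v Φ + ENNReal.ofReal (C * s ^ 2 * L ^ 2 / ‖(fun j => (n j : ℝ))‖ ^ 2)

/-- Periodic BEC for ONE potential `v` (the body of the consequent of `GDTransfer` =
`BECPeriodicReduction.PeriodicBEC` = stmt-0826, verbatim). [this route, crux 9482 consequent] -/
def PeriodicBECAt (v : ℝ → ℝ≥0∞) : Prop :=
  ∃ ρ₀ : ℝ, 0 < ρ₀ ∧ ∀ ρ : ℝ, 0 < ρ → ρ < ρ₀ → ∃ c : ℝ, 0 < c ∧ ∀ᶠ N : ℕ in Filter.atTop, ∃ δ : ENNReal, 0 < δ ∧ ∀ Ψ : Literature.MathematicalPhysics.QuantumManyBody.BoseGas.PeriodicTrialState N (Literature.MathematicalPhysics.QuantumManyBody.BoseGas.sideLength ρ N), Literature.MathematicalPhysics.QuantumManyBody.BoseGas.periodicEnergy v Ψ ≤ Literature.MathematicalPhysics.QuantumManyBody.BoseGas.periodicGroundStateEnergy v N (Literature.MathematicalPhysics.QuantumManyBody.BoseGas.sideLength ρ N) + δ → ENNReal.ofReal (c * N) ≤ Literature.MathematicalPhysics.QuantumManyBody.BoseGas.condensateOccupation N (Literature.MathematicalPhysics.QuantumManyBody.BoseGas.sideLength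 ρ N) Ψ.ψ

/-- The consequent of `GDTransfer`: periodic BEC for every admissible `v`. [this route] -/
def Consequent : Prop :=
  ∀ v : ℝ → ℝ≥0∞, IsRepulsiveFiniteRange v → PeriodicBECAt v

/-- `GaussianDominationCan` is the pointwise statement for all admissible `v` (by `Iff.rfl`). [this route] -/
theorem gaussianDominationCan_iff :
    GaussianDominationCan ↔ ∀ v : ℝ → ℝ≥0∞, IsRepulsiveFiniteRange v → GDCanAt v :=
  Iff.rfl

/-- `GDTransfer` is literally `GaussianDominationCan → Consequent` (by `Iff.rfl`). [this route] -/
theorem gdTransfer_iff : GDTransfer ↔ (GaussianDominationCan → Consequent) :=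
  Iff.rfl

/-- The crux is implied by its consequent alone: whoever proves periodic BEC proves `GDTransfer`
without Gaussian domination. [folklore] -/
theorem gdTransfer_of_consequent (h : Consequent) : GDTransfer :=
  fun _ => h

/-- The crux is implied by the NEGATION of its antecedent: a refutation of crux 9479 closes 9482
vacuously (and breaks the route at 9479 instead). [folklore] -/
theorem gdTransfer_of_not_gaussianDominationCan (h : ¬ GaussianDominationCan) : GDTransfer :=
  fun hG => absurd hG h

/-- **What a disproof of the crux is.** `¬ GDTransfer` holds iff T = 0 Gaussian domination holds for
every admissible potential AND periodic BEC fails for some admissible potential. [folklore] -/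
theorem not_gdTransfer_iff : ¬ GDTransfer ↔ GaussianDominationCan ∧ ¬ Consequent := by
  rw [gdTransfer_iff]
  constructor
  · intro h
    by_contra h'
    exact h fun hG => by_contra fun hC => h' ⟨hG, hC⟩
  · rintro ⟨hG, hC⟩ h
    exact hC (h hG)

/-- Hence any refutation of the crux refutes periodic BEC (the crux of route BECPeriodicReduction,
stmt-0826) — the physical content of the summit conjunct on the torus. [folklore] -/
theorem not_consequent_of_not_gdTransfer (h : ¬ GDTransfer) : ¬ Consequent :=
  (not_gdTransfer_iff.1 h).2

/-- … and proves crux 9479. [folklore] -/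
theorem gaussianDominationCan_of_not_gdTransfer (h : ¬ GDTransfer) : GaussianDominationCan :=
  (not_gdTransfer_iff.1 h).1

/-! ## §2 The chord form is the squared (KLS) form -/

/-- **Chord ⇔ square** over the reals: `(∀ s ≥ 0, s·b ≤ d + c·s²) ↔ b² ≤ 4cd` for `b, d ≥ 0 < c`
(optimise at `s = b/(2c)`; conversely complete the square). This is how `GaussianDominationCan`'s
"for every `s ≥ 0`" is consumed by the transfer: `|⟨Φ,Λ_k†Φ⟩|² ≤ C (L²/‖n‖²)(E(Φ) − E₀)`. [folklore] -/
theorem chord_iff_sq {b c d : ℝ} (hb : 0 ≤ b) (hc : 0 < c) :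
    (∀ s : ℝ, 0 ≤ s → s * b ≤ d + c * s ^ 2) ↔ b ^ 2 ≤ 4 * c * d := by
  constructor
  · intro h
    have hs : 0 ≤ b / (2 * c) := by positivity
    have h1 := h _ hs
    have h2 : b / (2 * c) * b = b ^ 2 / (2 * c) := by ring
    have h3 : c * (b / (2 * c)) ^ 2 = b ^ 2 / (4 * c) := by
      field_simp
      ring
    rw [h2, h3] at h1
    have h4 : b ^ 2 / (2 * c) - b ^ 2 / (4 * c) = b ^ 2 / (4 * c) := by
      field_simp
      ring
    have h5 : b ^ 2 / (4 * c) ≤ d := by linarith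
    rwa [div_le_iff₀ (by positivity), mul_comm] at h5
  · intro h s _
    nlinarith [sq_nonneg (2 * c * s - b), hc]

/-- **Chord ⇔ square** in the `ℝ≥0∞` shape of `GaussianDominationCan`: at a state of finite energy
`e` above a finite ground-state energy `e₀ ≤ e`, the family of chord inequalities
`e₀ + ofReal(s·X) ≤ e + ofReal(C'·s²)` (`s ≥ 0`) is equivalent to `X² ≤ 4 C' (e − e₀)`.
(At `e = ⊤` every chord inequality is `_ ≤ ⊤`: gen-1's `gdChord_of_energy_top`.) [folklore] -/
theorem ennreal_chord_iff_sq {e₀ e : ℝ≥0∞} (he : e ≠ ⊤) (h0e : e₀ ≤ e) {X C' : ℝ} (hX : 0 ≤ X)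
    (hC : 0 < C') :
    (∀ s : ℝ, 0 ≤ s → e₀ + ENNReal.ofReal (s * X) ≤ e + ENNReal.ofReal (C' * s ^ 2)) ↔
      X ^ 2 ≤ 4 * C' * (e - e₀).toReal := by
  have he₀ : e₀ ≠ ⊤ := ne_top_of_le_ne_top he h0e
  have hd : 0 ≤ (e - e₀).toReal := ENNReal.toReal_nonneg
  rw [← chord_iff_sq hX hC (d := (e - e₀).toReal)]
  have key : ∀ s : ℝ, 0 ≤ s →
      (e₀ + ENNReal.ofReal (s * X) ≤ e + ENNReal.ofReal (C' * s ^ 2) ↔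
        s * X ≤ (e - e₀).toReal + C' * s ^ 2) := by
    intro s hs
    have hCs : 0 ≤ C' * s ^ 2 := by positivity
    have hsub : e - e₀ ≠ ⊤ := ENNReal.sub_ne_top he
    have hrhs : e + ENNReal.ofReal (C' * s ^ 2) =
        e₀ + ENNReal.ofReal ((e - e₀).toReal + C' * s ^ 2) := by
      rw [ENNReal.ofReal_add hd hCs, ENNReal.ofReal_toReal hsub, ← add_assoc,
        add_tsub_cancel_of_le h0e]
    rw [hrhs, ENNReal.add_le_add_iff_left he₀, ENNReal.ofReal_le_ofReal_iff (by positivity)]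
  constructor
  · intro h s hs
    exact (key s hs).1 (h s hs)
  · intro h s hs
    exact (key s hs).2 (h s hs)

/-! ## §3 The free corner is closed on both sides -/

/-- `v = 0` is admissible. [folklore] -/
theorem isRepulsiveFiniteRange_zero : IsRepulsiveFiniteRange (0 : ℝ → ℝ≥0∞) :=
  ⟨measurable_const, 0, fun _ _ => rfl⟩

/-- **Periodic BEC holds for the free gas** (`c = 1/2`, window one kinetic gap per particle): the
tree theorem `periodicBEC_antecedent_free` (LSSY Lemma 4.1 / (5.15)–(5.17) at `R = 0`). So the
consequent of the crux cannot be refuted at `v = 0`. [cite: LSSY2005, Ch. 5 (5.15)–(5.17)] -/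
theorem periodicBECAt_zero : PeriodicBECAt 0 :=
  Literature.Barriers.AtomisticToContinuum.BoseGas.periodicBEC_antecedent_free

/-- Hence the pointwise transfer at `v = 0` holds outright, whatever the status of `GDCanAt 0`
(which the route reviews checked by hand: displaced oscillator in the LNSS excitation picture,
`C = 1/(4π²)`). The free gas is useless to BOTH sides of this crux. [folklore] -/
theorem gdTransferAt_zero : GDCanAt 0 → PeriodicBECAt 0 :=
  fun _ => periodicBECAt_zero

/-- The consequent is not junk-false: it has an admissible instance (`v = 0`). [folklore] -/
theorem exists_admissible_periodicBECAt : ∃ v : ℝ → ℝ≥0∞, IsRepulsiveFiniteRange v ∧ PeriodicBECAt v :=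
  ⟨0, isRepulsiveFiniteRange_zero, periodicBECAt_zero⟩

/-! ## §4 Dimension is load-bearing for the KLS mode count

The transfer's bookkeeping: in the window `0 < |k| ≤ M√ρ` on the torus of side `L` in `d`
dimensions there are `≍ (M√ρ L)^d = M^d ρ^{d/2} L^d = M^d ρ^{d/2-1} N` modes (`N = ρL^d`), each
carrying the KLS bound `n_k ≤ A(1 + B√ρ/|k|)`, `A = O(√C)`. The `A`-part of the window sum is the
fraction `M^d ρ^{d/2-1}` of `N`: it vanishes as `ρ → 0` iff `d/2 - 1 > 0`, i.e. iff `d ≥ 3`.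
(`d = 2`: a fixed fraction `M²` — no certificate although BEC holds at `T = 0`; `d = 1`: divergent,
consistent with the Luttinger liquid, where the analogue of Gaussian domination (finite phase
stiffness, `ρ_s = ρ` by Galilei invariance) holds WITHOUT condensation.) So the implication cannot be
proved "abstractly" from GD + double commutators: the `Fin 3` of the statement enters through the
density of states. -/

/-- The window fraction `ρ ↦ ρ^{d/2-1}` tends to `0` as `ρ ↓ 0` iff `d ≥ 3` (natural `d ≥ 1`).
[folklore] -/
theorem window_fraction_vanishes_iff_three_le {d : ℕ} (hd : 1 ≤ d) :
    Tendsto (fun ρ : ℝ => ρ ^ ((d : ℝ) / 2 - 1)) (nhdsWithin 0 (Set.Ioi 0)) (nhds 0) ↔ 3 ≤ d := by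
  constructor
  · intro h
    by_contra hlt
    have hlt' : d < 3 := not_le.mp hlt
    interval_cases d
    · -- d = 1: ρ^{-1/2} → ∞, not 0
      have h2 : Tendsto (fun ρ : ℝ => ρ ^ ((1 : ℕ) / 2 - 1 : ℝ)) (nhdsWithin 0 (Set.Ioi 0)) atTop := by
        have : ((1 : ℕ) / 2 - 1 : ℝ) = -(1 / 2 : ℝ) := by norm_num
        rw [this]
        exact tendsto_rpow_neg_nhdsGT_zero (by norm_num : (-(1 / 2) : ℝ) < 0)
      exact not_tendsto_nhds_of_tendsto_atTop h2 0 h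
    · -- d = 2: ρ^0 = 1
      have h2 : Tendsto (fun ρ : ℝ => ρ ^ ((2 : ℕ) / 2 - 1 : ℝ)) (nhdsWithin 0 (Set.Ioi 0)) (nhds 1) := by
        have : ((2 : ℕ) / 2 - 1 : ℝ) = 0 := by norm_num
        simp only [this, Real.rpow_zero]
        exact tendsto_const_nhds
      exact zero_ne_one (tendsto_nhds_unique h h2)
  · intro h3
    have hpos : 0 < (d : ℝ) / 2 - 1 := by
      have : (3 : ℝ) ≤ d := by exact_mod_cast h3
      linarith
    have h := (Real.continuousAt_rpow_const 0 ((d : ℝ) / 2 - 1) (Or.inr hpos.le)).tendsto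
    rw [Real.zero_rpow hpos.ne'] at h
    exact h.mono_left nhdsWithin_le_nhds

/-- The `d = 3` instance used by the transfer: the window fraction `M³ρ^{1/2}` is `o(1)` as `ρ → 0`
for every fixed `M`. [folklore] -/
theorem window_fraction_three (M : ℝ) :
    Tendsto (fun ρ : ℝ => M ^ 3 * ρ ^ ((3 : ℕ) / 2 - 1 : ℝ)) (nhdsWithin 0 (Set.Ioi 0)) (nhds 0) := by
  simpa using ((window_fraction_vanishes_iff_three_le (d := 3) (by norm_num)).2 le_rfl).const_mul (M ^ 3)

/-! ### §4b The `d = 3` count that makes the `B`-term uniform in `L`, and its failure in `d = 1`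

With `n_k ≤ A(1 + B√ρ/|k|)` on the window `0 < ‖n‖∞ ≤ J` (`k = 2πn/L`, `J ≍ M√ρ L/2π`) the `B`-part
of the window sum is `B√ρ (L/2π) ∑_{0<‖n‖∞≤J} 1/‖n‖` and must be `o(N) = o(ρL³)` UNIFORMLY in `L`:
this needs `∑_{0<‖n‖∞≤J} 1/‖n‖∞ = O(J²)` (then the part is `≍ B M²√ρ·N`), which is the shell count
`#{‖n‖∞ = j} = 24j² + 2` of `ℤ³` (`sum_inv_supNorm_le`: `≤ 13J(J+1)`); the trivial count `O(J³)`
would give `B M³ρ L·N`, growing with `L`. In `d = 1` the same sum is `2H_J`, unbounded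
(`harmonic_unbounded`), where `O(J^{d-1}) = O(1)` would be needed. -/

/-- The sup-norm box `{n ∈ ℤ³ : ‖n‖∞ ≤ J}`. [folklore] -/
def box (J : ℕ) : Finset (Fin 3 → ℤ) := Fintype.piFinset fun _ : Fin 3 => Finset.Icc (-(J : ℤ)) J

theorem mem_box {J : ℕ} {n : Fin 3 → ℤ} : n ∈ box J ↔ ∀ i, |n i| ≤ J := by
  simp [box, Fintype.mem_piFinset, abs_le]

theorem zero_mem_box (J : ℕ) : (0 : Fin 3 → ℤ) ∈ box J := by
  simp [mem_box]

theorem box_mono {J K : ℕ} (h : J ≤ K) : box J ⊆ box K := fun _ hn =>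
  mem_box.2 fun i => (mem_box.1 hn i).trans (by exact_mod_cast h)

/-- `#{n ∈ ℤ³ : ‖n‖∞ ≤ J} = (2J+1)³`. [folklore] -/
theorem card_box (J : ℕ) : (box J).card = (2 * J + 1) ^ 3 := by
  rw [box, Fintype.card_piFinset, Finset.prod_const, Finset.card_univ, Fintype.card_fin,
    Int.card_Icc]
  have : (J : ℤ) + 1 - -(J : ℤ) = ((2 * J + 1 : ℕ) : ℤ) := by push_cast; ring
  rw [this, Int.toNat_natCast]

/-- The shell `‖n‖∞ = J + 1` has `24(J+1)² + 2` points. [folklore] -/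
theorem card_shell (J : ℕ) : (box (J + 1) \ box J).card = 24 * (J + 1) ^ 2 + 2 := by
  rw [Finset.card_sdiff_of_subset (box_mono (Nat.le_succ J)), card_box, card_box]
  show (2 * (J + 1) + 1) ^ 3 - (2 * J + 1) ^ 3 = 24 * (J + 1) ^ 2 + 2
  have h : (2 * (J + 1) + 1) ^ 3 = (2 * J + 1) ^ 3 + (24 * (J + 1) ^ 2 + 2) := by ring
  rw [h, Nat.add_sub_cancel_left]

/-- Outside the box of radius `J` the real sup norm is `≥ J + 1`. [folklore] -/
theorem le_norm_of_not_mem_box {n : Fin 3 → ℤ} {J : ℕ} (h : n ∉ box J) :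
    (J : ℝ) + 1 ≤ ‖(fun j => (n j : ℝ))‖ := by
  simp only [mem_box, not_forall, not_le] at h
  obtain ⟨i, hi⟩ := h
  have h1 : (J : ℝ) + 1 ≤ |(n i : ℝ)| := by
    rw [← Int.cast_abs]
    have : (J : ℤ) + 1 ≤ |n i| := hi
    exact_mod_cast this
  exact h1.trans (by simpa [Real.norm_eq_abs] using norm_le_pi_norm (fun j => (n j : ℝ)) i)

/-- Splitting the punctured box of radius `J + 1` into the punctured box of radius `J` and the shell.
[folklore] -/
theorem sum_box_succ (J : ℕ) (f : (Fin 3 → ℤ) → ℝ) :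
    ∑ n ∈ (box (J + 1)).erase 0, f n =
      ∑ n ∈ (box J).erase 0, f n + ∑ n ∈ box (J + 1) \ box J, f n := by
  have h : (box (J + 1)).erase 0 = (box J).erase 0 ∪ (box (J + 1) \ box J) := by
    ext n
    simp only [Finset.mem_erase, Finset.mem_union, Finset.mem_sdiff]
    constructor
    · rintro ⟨hn0, hn⟩
      by_cases hJ : n ∈ box J
      · exact Or.inl ⟨hn0, hJ⟩
      · exact Or.inr ⟨hn, hJ⟩
    · rintro (⟨hn0, hn⟩ | ⟨hn, hJ⟩)
      · exact ⟨hn0, box_mono (Nat.le_succ J) hn⟩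
      · exact ⟨fun h0 => hJ (h0 ▸ zero_mem_box J), hn⟩
  rw [h, Finset.sum_union]
  exact Finset.disjoint_left.2 fun n hn hn' => (Finset.mem_sdiff.1 hn').2 (Finset.mem_erase.1 hn).2

/-- The shell contributes `≤ (24(J+1)² + 2)/(J+1) ≤ 26(J+1)` to `∑ 1/‖n‖∞`. [folklore] -/
theorem sum_shell_le (J : ℕ) :
    ∑ n ∈ box (J + 1) \ box J, (1 : ℝ) / ‖(fun j => (n j : ℝ))‖ ≤ 26 * (J + 1) := by
  have hJ : (0 : ℝ) < J + 1 := by positivity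
  calc ∑ n ∈ box (J + 1) \ box J, (1 : ℝ) / ‖(fun j => (n j : ℝ))‖
      ≤ ∑ _n ∈ box (J + 1) \ box J, (1 : ℝ) / (J + 1) :=
        Finset.sum_le_sum fun n hn =>
          one_div_le_one_div_of_le hJ (le_norm_of_not_mem_box (Finset.mem_sdiff.1 hn).2)
    _ = ((24 * (J + 1) ^ 2 + 2 : ℕ) : ℝ) * (1 / ((J : ℝ) + 1)) := by
        rw [Finset.sum_const, card_shell, nsmul_eq_mul]
    _ ≤ 26 * (J + 1) := by
        rw [mul_one_div, div_le_iff₀ hJ]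
        push_cast
        nlinarith

/-- **The `d = 3` lattice count**: `∑_{0 < ‖n‖∞ ≤ J} 1/‖n‖∞ ≤ 13 J (J+1)` over `n ∈ ℤ³` (real sup
norm, as in the window and the error term of `GaussianDominationCan`). This `O(J²)` — not the
`O(J³)` number of modes — is what makes the `√ρ/|k|` part of the KLS window sum `o(N)` uniformly in
`L`. [folklore] -/
theorem sum_inv_supNorm_le (J : ℕ) :
    ∑ n ∈ (box J).erase 0, (1 : ℝ) / ‖(fun j => (n j : ℝ))‖ ≤ 13 * J * (J + 1) := by
  induction J with
  | zero =>
    have h : (box 0).erase 0 = ∅ := by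
      ext n
      simp only [Finset.mem_erase, Finset.notMem_empty, iff_false, not_and]
      intro hn0 hn
      refine hn0 (funext fun i => ?_)
      have := mem_box.1 hn i
      simpa using this
    simp [h]
  | succ J ih =>
    rw [sum_box_succ]
    have h := sum_shell_le J
    push_cast at ih h ⊢
    nlinarith

/-- **The `d = 1` analogue diverges**: the half-line sum `∑_{1 ≤ n ≤ J} 1/n` is unbounded, whereas
an `L`-uniform window bound in `d = 1` would need `∑_{0<|n|≤J} 1/|n| = O(J^{d-1}) = O(1)`.
[folklore] -/
theorem harmonic_unbounded (K : ℝ) : ∃ J : ℕ, K < ∑ j ∈ Finset.range J, (1 : ℝ) / (j + 1) :=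
  ((Real.tendsto_sum_range_one_div_nat_succ_atTop.eventually (eventually_gt_atTop K))).exists

/-! ## §5 Hard cores by truncation: `∫v`-constants blow up, `a`-constants do not

The transfer's double commutator `c_k = ⟨ζ,(H−E₀)ζ⟩`, `ζ = (Λ_k+Λ_k†)Ψ₀`, splits as
`k²⟨(n_k+1)1_{n₀≥1} − n_k⟩ + ½⟨[Λ,[V,Λ†]] + [Λ†,[V,Λ]]⟩`; the kinetic part is `≤ k²`, the potential
part is what the route calls `C'ρ`. Every estimate of `[v_{ij}, P_i]` by the size of `v` gives
`C' ∝ ∫v` (or `‖v‖∞ R₀³`). For the hard core the bare `ζ` has infinite energy (gen-1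
`gdChord_of_energy_top`), and the route's fallback "monotone truncation `v_n ↑ v` with constants
tracked" meets the following elementary obstruction: along the truncations of the hard core of radius
`a` the integrals `∫v_n = n·(4π/3)a³` are unbounded (`lintegral_truncHardCore`,
`tendsto_lintegral_truncHardCore`) while the scattering lengths stay `≤ a`
(`scatteringLength_truncHardCore_le`) — and the consequent's constants (`ρ₀`, `c`) for the hard core
are finite (gen-1 `threshold_le_of_hardCore`: `ρ₀ ≤ 8/a³`). So a proof reaching hard cores through
`v_n` must bound `c_k` by the SCATTERING LENGTH of `v_n` (a renormalised, Dyson/LHY-type commutator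
estimate — the "contact cutoff" of the route's why-might-fail), never by `∫v_n` or `‖v_n‖∞`: with
`∫v_n`-constants the KLS output `n_k ≤ √(2C)(1 + √(C'_n ρ)/k)` degenerates as `n → ∞`.

Moreover the ANTECEDENT itself is pointwise in `v` with `v`-dependent constants (`∃ ρ₀ C N₀` after
`v`): `GDCanAt (truncHardCore a n)` for every `n` yields constants `C_n, ρ₀,ₙ` with no uniformity, and
the consequent's `∃ δ` (chosen by the prover, possibly tiny) does not compose along `n → ∞` either
(a hard-core near-minimiser `Ψ` is only an `(E₀(v) − E₀(v_n) + δ)`-near-minimiser for `v_n`). So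
truncation buys nothing from the hypothesis as typed: the hard-core instance must be attacked with
`GDCanAt (hardCorePotential a)` itself, whose informative trial states vanish on the cores — the cored
variation `ζ ↦ Fζ` is forced, not optional. -/

/-- The hard core of radius `a` truncated at height `n`: `v_n(r) = n` for `r < a`, `0` otherwise
(`= hardCorePotential a ⊓ n`). [folklore] -/
def truncHardCore (a : ℝ) (n : ℕ) : ℝ → ℝ≥0∞ := fun r => if r < a then (n : ℝ≥0∞) else 0

theorem truncHardCore_le (a : ℝ) (n : ℕ) (r : ℝ) : truncHardCore a n r ≤ hardCorePotential a r := by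
  unfold truncHardCore hardCorePotential
  split_ifs <;> simp

/-- The truncations are admissible (measurable, range `a`). [folklore] -/
theorem isRepulsiveFiniteRange_truncHardCore (a : ℝ) (n : ℕ) :
    IsRepulsiveFiniteRange (truncHardCore a n) :=
  ⟨Measurable.ite measurableSet_Iio measurable_const measurable_const, a, fun r hr => by
    simp [truncHardCore, not_lt.2 hr.le]⟩

/-- The truncations increase to the hard core pointwise: `v_n(r) = n → ⊤` inside the core. [folklore] -/
theorem tendsto_truncHardCore_of_lt {a r : ℝ} (h : r < a) :
    Tendsto (fun n : ℕ => truncHardCore a n r) atTop (nhds ⊤) := by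
  simp only [truncHardCore, if_pos h]
  exact ENNReal.tendsto_nat_nhds_top

/-- `∫_{ℝ³} v_n(|x|) dx = n · |B_a| = n · (4π/3) a³`. [folklore] -/
theorem lintegral_truncHardCore (a : ℝ) (n : ℕ) :
    ∫⁻ x : Space, truncHardCore a n ‖x‖ =
      (n : ℝ≥0∞) * (ENNReal.ofReal a ^ 3 * ENNReal.ofReal (Real.pi * 4 / 3)) := by
  have h : (fun x : Space => truncHardCore a n ‖x‖) =
      (Metric.ball (0 : Space) a).indicator fun _ => (n : ℝ≥0∞) := by
    ext x
    by_cases hx : ‖x‖ < a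
    · rw [Set.indicator_of_mem (by simpa using hx)]
      simp [truncHardCore, hx]
    · rw [Set.indicator_of_notMem (by simpa using hx)]
      simp [truncHardCore, hx]
  rw [h, lintegral_indicator_const measurableSet_ball, EuclideanSpace.volume_ball_fin_three]

/-- … hence the integrals of the truncations are unbounded (`a > 0`). [folklore] -/
theorem tendsto_lintegral_truncHardCore {a : ℝ} (ha : 0 < a) :
    Tendsto (fun n : ℕ => ∫⁻ x : Space, truncHardCore a n ‖x‖) atTop (nhds ⊤) := by
  simp_rw [lintegral_truncHardCore]
  have hc : ENNReal.ofReal a ^ 3 * ENNReal.ofReal (Real.pi * 4 / 3) ≠ 0 := by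
    apply mul_ne_zero
    · exact pow_ne_zero _ (by rwa [Ne, ENNReal.ofReal_eq_zero, not_le])
    · rw [Ne, ENNReal.ofReal_eq_zero, not_le]; positivity
  have h := ENNReal.Tendsto.mul_const ENNReal.tendsto_nat_nhds_top (Or.inl ENNReal.top_ne_zero)
    (b := ENNReal.ofReal a ^ 3 * ENNReal.ofReal (Real.pi * 4 / 3))
  rwa [ENNReal.top_mul hc] at h

/-- … while the scattering lengths of the truncations stay below the radius:
`a(v_n) ≤ a(hard core) = a`. [cite: LSSY2005, App. C, Lemma C.2 (C) and Ch. 2 after (2.1)] -/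
theorem scatteringLength_truncHardCore_le (a : ℝ) (n : ℕ) :
    scatteringLength (truncHardCore a n) ≤ ENNReal.ofReal a := by
  rw [← scatteringLength_hardCorePotential a]
  exact scatteringLength_mono (truncHardCore_le a n)

/-- **Summary of §5**: along an admissible sequence increasing to the hard core, `∫v_n → ∞` and
`a(v_n) ≤ a`: constants of the transfer may depend on `v` only through quantities bounded along such
sequences (the scattering length), or the hard-core instance of the consequent — which the crux
asserts (`IsRepulsiveFiniteRange` includes `hardCorePotential a`) — is not reached. [folklore] -/
theorem truncation_dichotomy {a : ℝ} (ha : 0 < a) :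
    (∀ n : ℕ, IsRepulsiveFiniteRange (truncHardCore a n)) ∧
    (∀ n : ℕ, ∀ r, truncHardCore a n r ≤ hardCorePotential a r) ∧
    Tendsto (fun n : ℕ => ∫⁻ x : Space, truncHardCore a n ‖x‖) atTop (nhds ⊤) ∧
    (∀ n : ℕ, scatteringLength (truncHardCore a n) ≤ ENNReal.ofReal a) ∧
    IsRepulsiveFiniteRange (hardCorePotential a) :=
  ⟨isRepulsiveFiniteRange_truncHardCore a, truncHardCore_le a, tendsto_lintegral_truncHardCore ha,
    scatteringLength_truncHardCore_le a, isRepulsiveFiniteRange_hardCorePotential a⟩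

/-! ## §6 The free value `C = 1/(4π²)` is sharp — and the crux's inline source functional is validated

CLOSED in gen-2 v3 (was the typed near-miss of v1/v2). At `v = 0`, window mode `n = e₁`, the
one-excitation superposition `Φ_t = Ψ_{A_t}/‖Ψ_{A_t}‖`, `A_t = X₀^{n+1} + t X₀ⁿX₁` on the two modes
`0 ↦ 0`, `1 ↦ e₁` (tree `Fock.sectorTrialState`), has energy `(4π²/L²) t²n!/((n+1)! + t²n!)`
(`periodicEnergy_trialΦ`) and the crux's source — the inline `let P/Q/Θ` functional, evaluated
VERBATIM (`norm_source_integral_trialΦ` rewrites the very term produced by the crux's binders) — has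
norm `|t| n!/(((n+1)! + t²n!)√(n+1))`; with `t = ε√(n+1)` these are `(4π²/L²)ε²/(1+ε²)` and the
source term `2ε/(1+ε²)`, so the chord inequality at `s = ε/(CL²(1+ε²))` forces `4π²C(1+ε²) ≥ 1`:
every `C < 1/(4π²)` fails (`gdBody_zero_false`, any window `M`, any `ρ₀`, `N₀`; `free_constant_ge`;
`gdCanAtWith_zero_false`; `gaussianDominationCan_free_constant_ge`). On the way the configuration-space
operators of the crux are computed on plane-wave word sums: `cellAvg_wordSum` (`P_i` kills the words
with non-zero momentum in slot `i`), `foldr_step_wordSum` (`Q_S` = projection onto the words whose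
zero-momentum slots are exactly `S`), `theta_wordSum` (`Θ = ∑_{S∋0}|S|^{-1/2}Q_S` keeps the words
condensed in slot `0` with weight `|Z(k)|^{-1/2}` — i.e. `P₀ n̂₀^{-1/2}` as the planner claims),
`integral_cellN_conj_wordSum_wave_wordSum` (orthogonality with the extra `e^{ik·x₀}`). CONSEQUENCE FOR
THE CRUX: the antecedent `GaussianDominationCan` is a faithful typing of `E₀(H - s(Λ_k^θ+Λ_k^{θ†})) ≥
E₀ - C's²/k²` (no junk in the source functional: it returns `2|⟨Φ,Λ_k†Φ⟩|` on this two-pattern state,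
`Λ_k† = a_k†a_0n̂₀^{-1/2}`), and its constant at `v = 0` is pinned to the displaced-oscillator value. -/

/-- `GDCanAt` with the constant `C` pulled out of the existential. [this route, crux 9479] -/
def GDCanAtWith (v : ℝ → ℝ≥0∞) (C : ℝ) : Prop :=
  ∀ M : ℝ, 0 < M → ∃ ρ₀ : ℝ, 0 < ρ₀ ∧ ∃ N₀ : ℕ, ∀ m : ℕ, N₀ ≤ m + 1 → ∀ L : ℝ, 0 < L → ((m + 1 : ℕ) : ℝ) ≤ ρ₀ * L ^ 3 → ∀ n : Fin 3 → ℤ, n ≠ 0 → 2 * Real.pi * ‖(fun j => (n j : ℝ))‖ / L ≤ M * Real.sqrt ((m + 1 : ℕ) / L ^ 3) → ∀ s : ℝ, 0 ≤ s → ∀ Φ : Literature.MathematicalPhysics.QuantumManyBody.BoseGas.PeriodicTrialState (m + 1) L, let P : Fin (m + 1) → (Literature.MathematicalPhysics.QuantumManyBody.BoseGas.Config (m + 1) → ℂ) → (Literature.MathematicalPhysics.QuantumManyBody.BoseGas.Config (m + 1) → ℂ) := fun i g X => ((L ^ 3)⁻¹ : ℝ) • ∫ y in Literature.MathematicalPhysics.QuantumManyBody.BoseGas.cell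 L, g (Function.update X i y); let Q : Finset (Fin (m + 1)) → (Literature.MathematicalPhysics.QuantumManyBody.BoseGas.Config (m + 1) → ℂ) → (Literature.MathematicalPhysics.QuantumManyBody.BoseGas.Config (m + 1) → ℂ) := fun S g => (List.finRange (m + 1)).foldr (fun i h => if i ∈ S then P i h else h - P i h) g; let Θ : Literature.MathematicalPhysics.QuantumManyBody.BoseGas.Config (m + 1) → ℂ := fun X => ∑ S ∈ (Finset.univ : Finset (Finset (Fin (m + 1)))).filter (fun S => (0 : Fin (m + 1)) ∈ S), ((Real.sqrt (S.card : ℝ))⁻¹ : ℂ) * Q S Φ.ψ X; Literature.MathematicalPhysics.QuantumManyBody.BoseGas.periodicGroundStateEnergy v (m + 1) L + ENNReal.ofReal (s * (2 * (m + 1) * ‖∫ X in Literature.MathematicalPhysics.QuantumManyBody.BoseGas.cellN (m + 1) L, (starRingEnd ℂ) (Φ.ψ X) * Complex.exp (Complex.I * ↑(2 * Real.pi / L * ∑ j, (n j : ℝ) * X 0 j)) * Θ X‖)) ≤ Literature.MathematicalPhysics.QuantumManyBody.BoseGas.periodicEnergy v Φ + ENNReal.ofReal (C * s ^ 2 * L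 ^ 2 / ‖(fun j => (n j : ℝ))‖ ^ 2)

/-- `GDCanAt v` is `∃ C > 0, GDCanAtWith v C` with `C` allowed to depend on `M` (re-bracketing of the
existentials). [this route] -/
theorem gdCanAt_iff (v : ℝ → ℝ≥0∞) :
    GDCanAt v ↔ ∀ M : ℝ, 0 < M → ∃ C : ℝ, 0 < C ∧ ∃ ρ₀ : ℝ, 0 < ρ₀ ∧ ∃ N₀ : ℕ, ∀ m : ℕ, N₀ ≤ m + 1 → ∀ L : ℝ, 0 < L → ((m + 1 : ℕ) : ℝ) ≤ ρ₀ * L ^ 3 → ∀ n : Fin 3 → ℤ, n ≠ 0 → 2 * Real.pi * ‖(fun j => (n j : ℝ))‖ / L ≤ M * Real.sqrt ((m + 1 : ℕ) / L ^ 3) → ∀ s : ℝ, 0 ≤ s → ∀ Φ : Literature.MathematicalPhysics.QuantumManyBody.BoseGas.PeriodicTrialState (m + 1) L, let P : Fin (m + 1) → (Literature.MathematicalPhysics.QuantumManyBody.BoseGas.Config (m + 1) → ℂ) → (Literature.MathematicalPhysics.QuantumManyBody.BoseGas.Config (m + 1) → ℂ) := fun i g X => ((L ^ 3)⁻¹ :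 ℝ) • ∫ y in Literature.MathematicalPhysics.QuantumManyBody.BoseGas.cell L, g (Function.update X i y); let Q : Finset (Fin (m + 1)) → (Literature.MathematicalPhysics.QuantumManyBody.BoseGas.Config (m + 1) → ℂ) → (Literature.MathematicalPhysics.QuantumManyBody.BoseGas.Config (m + 1) → ℂ) := fun S g => (List.finRange (m + 1)).foldr (fun i h => if i ∈ S then P i h else h - P i h) g; let Θ : Literature.MathematicalPhysics.QuantumManyBody.BoseGas.Config (m + 1) → ℂ := fun X => ∑ S ∈ (Finset.univ : Finset (Finset (Fin (m + 1)))).filter (fun S => (0 : Fin (m + 1)) ∈ S), ((Real.sqrt (S.card : ℝ))⁻¹ : ℂ) * Q S Φ.ψ X; Literature.MathematicalPhysics.QuantumManyBody.BoseGas.periodicGroundStateEnergy v (m + 1) L + ENNReal.ofReal (s * (2 * (m + 1) * ‖∫ X in Literature.MathematicalPhysics.QuantumManyBody.BoseGas.cellN (m + 1) L, (starRingEnd ℂ) (Φ.ψ X) * Complex.exp (Complex.I * ↑(2 * Real.pi / L * ∑ j, (n j : ℝ) * X 0 j)) * Θ X‖)) ≤ Literature.MathematicalPhysics.QuantumManyBody.BoseGas.periodicEnergy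 v Φ + ENNReal.ofReal (C * s ^ 2 * L ^ 2 / ‖(fun j => (n j : ℝ))‖ ^ 2) := by
  unfold GDCanAt
  constructor
  · intro h M hM
    obtain ⟨ρ₀, C, hρ₀, hC, N₀, h⟩ := h M hM
    exact ⟨C, hC, ρ₀, hρ₀, N₀, h⟩
  · intro h M hM
    obtain ⟨C, hC, ρ₀, hρ₀, N₀, h⟩ := h M hM
    exact ⟨ρ₀, C, hρ₀, hC, N₀, h⟩

/-- A uniform constant gives the crux's antecedent at `v`. [this route] -/
theorem gdCanAt_of_with {v : ℝ → ℝ≥0∞} {C : ℝ} (hC : 0 < C) (h : GDCanAtWith v C) : GDCanAt v := by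
  intro M hM
  obtain ⟨ρ₀, hρ₀, N₀, h⟩ := h M hM
  exact ⟨ρ₀, C, hρ₀, hC, N₀, h⟩


open MvPolynomial Literature.MathematicalPhysics.QuantumManyBody.BoseGas.Fock

section WordSums

variable {N : ℕ} {ι : Type*} [Fintype ι]

/-- A plane-wave word sum `∑_k a_k ∏ᵢ e_{e(kᵢ)}(xᵢ)` (the shape of `Fock.sectorWave`). [folklore] -/
def wordSum (L : ℝ) (e : ι → Momentum) (a : (Fin N → ι) → ℂ) (X : Config N) : ℂ :=
  ∑ k : Fin N → ι, a k * ∏ i, cellWave L (e (k i)) (X i)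

/-- The cell average in particle `i` — the operator `P i` of `GaussianDominationCan`
(`(P_i g)(X) = L⁻³ ∫_Ω g(x₁,…,x_{i-1},y,x_{i+1},…) dy`, the projection onto the constant mode of
particle `i`). [this route, crux 9479] -/
def cellAvg (L : ℝ) (i : Fin N) (g : Config N → ℂ) : Config N → ℂ :=
  fun X => ((L ^ 3)⁻¹ : ℝ) • ∫ y in cell L, g (Function.update X i y)

omit [Fintype ι] in
/-- Splitting the `i`-th factor off a plane-wave product evaluated at an updated configuration.
[folklore] -/
theorem prod_cellWave_update (L : ℝ) (e : ι → Momentum) (k : Fin N → ι) (X : Config N)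
    (i : Fin N) (y : Space) :
    ∏ l, cellWave L (e (k l)) (Function.update X i y l) =
      cellWave L (e (k i)) y * ∏ l ∈ Finset.univ.erase i, cellWave L (e (k l)) (X l) := by
  rw [← Finset.mul_prod_erase Finset.univ _ (Finset.mem_univ i), Function.update_self]
  congr 1
  refine Finset.prod_congr rfl fun l hl => ?_
  rw [Function.update_of_ne (Finset.ne_of_mem_erase hl)]

omit [Fintype ι] in
/-- The same splitting at the configuration itself. [folklore] -/
theorem prod_cellWave_split (L : ℝ) (e : ι → Momentum) (k : Fin N → ι) (X : Config N)
    (i : Fin N) :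
    ∏ l, cellWave L (e (k l)) (X l) =
      cellWave L (e (k i)) (X i) * ∏ l ∈ Finset.univ.erase i, cellWave L (e (k l)) (X l) := by
  rw [← Finset.mul_prod_erase Finset.univ _ (Finset.mem_univ i)]

/-- **`P_i` kills the words with non-zero momentum in slot `i` and fixes the others**:
`P_i (∑_k a_k ∏e) = ∑_{k : e(kᵢ) = 0} a_k ∏e`. [folklore] -/
theorem cellAvg_wordSum {L : ℝ} (hL : 0 < L) (e : ι → Momentum) (a : (Fin N → ι) → ℂ)
    (i : Fin N) :
    cellAvg L i (wordSum L e a) = wordSum L e (fun k => if e (k i) = 0 then a k else 0) := by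
  classical
  funext X
  unfold cellAvg wordSum
  have hL3 : (L : ℂ) ^ 3 ≠ 0 := pow_ne_zero _ (by exact_mod_cast hL.ne')
  -- the integrand, factor by factor
  have hint : ∀ k : Fin N → ι, IntegrableOn
      (fun y : Space => a k * (cellWave L (e (k i)) y *
        ∏ l ∈ Finset.univ.erase i, cellWave L (e (k l)) (X l))) (cell L) volume := by
    intro k
    refine integrableOn_cell ?_
    exact continuous_const.mul ((continuous_cellWave L _).mul continuous_const)
  have h1 : (fun y => ∑ k : Fin N → ι, a k * ∏ l, cellWave L (e (k l)) (Function.update X i y l)) =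
      fun y => ∑ k : Fin N → ι, a k * (cellWave L (e (k i)) y *
        ∏ l ∈ Finset.univ.erase i, cellWave L (e (k l)) (X l)) := by
    funext y
    refine Finset.sum_congr rfl fun k _ => ?_
    rw [prod_cellWave_update]
  rw [h1, integral_finsetSum _ fun k _ => hint k]
  have h2 : ∀ k : Fin N → ι, ∫ y in cell L, a k * (cellWave L (e (k i)) y *
      ∏ l ∈ Finset.univ.erase i, cellWave L (e (k l)) (X l)) =
      a k * ((if e (k i) = 0 then (L : ℂ) ^ 3 else 0) *
        ∏ l ∈ Finset.univ.erase i, cellWave L (e (k l)) (X l)) := by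
    intro k
    rw [integral_const_mul, integral_mul_const, integral_cell_cellWave hL]
  simp only [h2]
  rw [Finset.smul_sum]
  refine Finset.sum_congr rfl fun k _ => ?_
  by_cases hk : e (k i) = 0
  · rw [if_pos hk, if_pos hk, prod_cellWave_split L e k X i, hk, cellWave_zero, one_mul,
      Complex.real_smul]
    push_cast
    rw [mul_left_comm (a k), ← mul_assoc, inv_mul_cancel₀ hL3, one_mul]
  · simp [hk]

/-- **`1 - P_i` keeps exactly the words with non-zero momentum in slot `i`.** [folklore] -/
theorem wordSum_sub_cellAvg {L : ℝ} (hL : 0 < L) (e : ι → Momentum) (a : (Fin N → ι) → ℂ)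
    (i : Fin N) :
    wordSum L e a - cellAvg L i (wordSum L e a) =
      wordSum L e (fun k => if e (k i) = 0 then 0 else a k) := by
  classical
  rw [cellAvg_wordSum hL]
  funext X
  simp only [Pi.sub_apply, wordSum, ← Finset.sum_sub_distrib]
  refine Finset.sum_congr rfl fun k _ => ?_
  by_cases hk : e (k i) = 0 <;> simp [hk]

/-- The GD step operator (`P_i` if `i ∈ S`, `1 - P_i` otherwise) folded over a list of slots acts
diagonally on word sums: a word survives iff for every listed slot `i`, `i ∈ S ↔ e(kᵢ) = 0`.
[folklore] -/
theorem foldr_step_wordSum {L : ℝ} (hL : 0 < L) (e : ι → Momentum) (S : Finset (Fin N))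
    (l : List (Fin N)) (a : (Fin N → ι) → ℂ) :
    l.foldr (fun i h => if i ∈ S then cellAvg L i h else h - cellAvg L i h) (wordSum L e a) =
      wordSum L e (fun k => if (∀ i ∈ l, (i ∈ S ↔ e (k i) = 0)) then a k else 0) := by
  induction l with
  | nil =>
    simp only [List.foldr_nil, List.not_mem_nil, IsEmpty.forall_iff, implies_true, if_true]
  | cons j l ih =>
    rw [List.foldr_cons, ih]
    by_cases hj : j ∈ S
    · rw [if_pos hj, cellAvg_wordSum hL]
      congr 1
      funext k
      by_cases hk : e (k j) = 0
      · by_cases hr : ∀ i ∈ l, (i ∈ S ↔ e (k i) = 0)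
        · rw [if_pos hk, if_pos hr, if_pos]
          intro i hi
          rcases List.mem_cons.1 hi with rfl | hi
          · exact iff_of_true hj hk
          · exact hr i hi
        · rw [if_pos hk, if_neg hr, if_neg]
          intro h
          exact hr fun i hi => h i (List.mem_cons_of_mem _ hi)
      · rw [if_neg hk, if_neg]
        intro h
        exact hk ((h j List.mem_cons_self).1 hj)
    · rw [if_neg hj, wordSum_sub_cellAvg hL]
      congr 1
      funext k
      by_cases hk : e (k j) = 0
      · rw [if_pos hk, if_neg]
        intro h
        exact hj ((h j List.mem_cons_self).2 hk)
      · by_cases hr : ∀ i ∈ l, (i ∈ S ↔ e (k i) = 0)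
        · rw [if_neg hk, if_pos hr, if_pos]
          intro i hi
          rcases List.mem_cons.1 hi with rfl | hi
          · exact iff_of_false hj hk
          · exact hr i hi
        · rw [if_neg hk, if_neg hr, if_neg]
          intro h
          exact hr fun i hi => h i (List.mem_cons_of_mem _ hi)

end WordSums

/-! ### `Θ = P₀ n̂₀^{-1/2}` on word sums, and the source integral -/

section Theta

variable {n : ℕ} {ι : Type*} [Fintype ι]

/-- The slots of a word carrying zero momentum. [folklore] -/
def zeroSlots (e : ι → Momentum) (k : Fin (n + 1) → ι) : Finset (Fin (n + 1)) :=
  Finset.univ.filter fun i => e (k i) = 0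

omit [Fintype ι] in
theorem mem_zeroSlots {e : ι → Momentum} {k : Fin (n + 1) → ι} {i : Fin (n + 1)} :
    i ∈ zeroSlots e k ↔ e (k i) = 0 := by
  simp [zeroSlots]

omit [Fintype ι] in
/-- The survival condition of the full fold is `S = zeroSlots`. [folklore] -/
theorem forall_finRange_iff_eq_zeroSlots (e : ι → Momentum) (k : Fin (n + 1) → ι)
    (S : Finset (Fin (n + 1))) :
    (∀ i ∈ List.finRange (n + 1), (i ∈ S ↔ e (k i) = 0)) ↔ S = zeroSlots e k := by
  rw [Finset.ext_iff]
  simp only [List.mem_finRange, forall_const, mem_zeroSlots]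

/-- **`Θ = ∑_{S ∋ 0} |S|^{-1/2} Q_S` on a word sum** keeps the words with zero momentum in slot
`0`, weighted by `|Z(k)|^{-1/2}`, `Z(k)` = the zero-momentum slots (the configuration-space form of
`P₀ n̂₀^{-1/2}`: `n̂₀ = |Z|` on a plane-wave product). [this route, crux 9479] -/
theorem theta_wordSum {L : ℝ} (hL : 0 < L) (e : ι → Momentum) (a : (Fin (n + 1) → ι) → ℂ)
    (X : Config (n + 1)) :
    ∑ S ∈ (Finset.univ : Finset (Finset (Fin (n + 1)))).filter (fun S => (0 : Fin (n + 1)) ∈ S),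
        ((Real.sqrt (S.card : ℝ))⁻¹ : ℂ) *
          (List.finRange (n + 1)).foldr
            (fun i h => if i ∈ S then cellAvg L i h else h - cellAvg L i h) (wordSum L e a) X =
      wordSum L e (fun k => if e (k 0) = 0 then
        ((Real.sqrt ((zeroSlots e k).card : ℝ))⁻¹ : ℂ) * a k else 0) X := by
  classical
  simp only [foldr_step_wordSum hL, forall_finRange_iff_eq_zeroSlots]
  unfold wordSum
  simp only [Finset.mul_sum]
  rw [Finset.sum_comm]
  refine Finset.sum_congr rfl fun k _ => ?_
  have h1 : ∀ S : Finset (Fin (n + 1)), ((Real.sqrt (S.card : ℝ))⁻¹ : ℂ) *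
      ((if S = zeroSlots e k then a k else 0) * ∏ i, cellWave L (e (k i)) (X i)) =
      if S = zeroSlots e k then ((Real.sqrt ((zeroSlots e k).card : ℝ))⁻¹ : ℂ) *
        (a k * ∏ i, cellWave L (e (k i)) (X i)) else 0 := by
    intro S
    split_ifs with h
    · rw [h]
    · rw [zero_mul, mul_zero]
  simp only [h1]
  rw [Finset.sum_ite_eq']
  simp only [Finset.mem_filter, Finset.mem_univ, true_and, mem_zeroSlots]
  split_ifs <;> ring

end Theta

section Source

variable {N : ℕ} {ι : Type*} [Fintype ι]

omit [Fintype ι] in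
/-- A single plane wave in slot `i₀` as a product over all slots. [folklore] -/
theorem cellWave_slot_eq_prod (L : ℝ) (m : Momentum) (X : Config N) (i₀ : Fin N) :
    cellWave L m (X i₀) = ∏ i, cellWave L (if i = i₀ then m else 0) (X i) := by
  classical
  have : ∀ i : Fin N, cellWave L (if i = i₀ then m else 0) (X i) =
      if i = i₀ then cellWave L m (X i) else 1 := by
    intro i
    split_ifs
    · rfl
    · exact cellWave_zero L (X i)
  simp only [this]
  rw [Finset.prod_ite_eq' Finset.univ i₀ (fun i => cellWave L m (X i)), if_pos (Finset.mem_univ _)]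

/-- **The source integral on word sums**: with an extra plane wave `e_m(x_{i₀})`,
`∫_{Λᴺ} conj(∑_k a_k∏e) e_m(x_{i₀}) (∑_k b_k∏e) = L^{3N} ∑_{k,k'} conj(a_k) b_{k'} [e∘k' - e∘k + m δ_{i₀} = 0]`.
[folklore] -/
theorem integral_cellN_conj_wordSum_wave_wordSum {L : ℝ} (hL : 0 < L) (e : ι → Momentum)
    (m : Momentum) (i₀ : Fin N) (a b : (Fin N → ι) → ℂ) :
    ∫ X in cellN N L, conj (wordSum L e a X) * cellWave L m (X i₀) * wordSum L e b X =
      ((L : ℂ) ^ 3) ^ N * ∑ k : Fin N → ι, ∑ k' : Fin N → ι, conj (a k) * b k' *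
        (if (fun i => e (k' i) - e (k i) + (if i = i₀ then m else 0)) = 0 then 1 else 0) := by
  classical
  have hexp : ∀ X : Config N, conj (wordSum L e a X) * cellWave L m (X i₀) * wordSum L e b X =
      ∑ k : Fin N → ι, ∑ k' : Fin N → ι, conj (a k) * b k' *
        ∏ i, cellWave L (e (k' i) - e (k i) + (if i = i₀ then m else 0)) (X i) := by
    intro X
    unfold wordSum
    rw [map_sum, Finset.sum_mul, Finset.sum_mul]
    refine Finset.sum_congr rfl fun k _ => ?_
    rw [Finset.mul_sum]
    refine Finset.sum_congr rfl fun k' _ => ?_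
    rw [map_mul, map_prod]
    simp only [conj_cellWave]
    rw [cellWave_slot_eq_prod L m X i₀]
    have hprod : (∏ i, cellWave L (-e (k i)) (X i)) * (∏ i, cellWave L (if i = i₀ then m else 0) (X i)) *
        ∏ i, cellWave L (e (k' i)) (X i) =
        ∏ i, cellWave L (e (k' i) - e (k i) + (if i = i₀ then m else 0)) (X i) := by
      rw [← Finset.prod_mul_distrib, ← Finset.prod_mul_distrib]
      refine Finset.prod_congr rfl fun i _ => ?_
      rw [← cellWave_add_index, ← cellWave_add_index]
      congr 1
      abel
    rw [← hprod]; ring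
  simp_rw [hexp]
  have hint : ∀ (k k' : Fin N → ι), IntegrableOn (fun X : Config N => conj (a k) * b k' *
      ∏ i, cellWave L (e (k' i) - e (k i) + (if i = i₀ then m else 0)) (X i)) (cellN N L) := by
    intro k k'
    refine integrableOn_cellN_of_bounded L (M := ‖conj (a k) * b k'‖) ?_ fun X => ?_
    · refine continuous_const.mul (continuous_finsetProd _ fun i _ => ?_)
      exact (continuous_cellWave L _).comp (continuous_apply i)
    · rw [norm_mul, norm_prod_cellWave, mul_one]
  rw [integral_finsetSum _ fun k _ => (integrable_finsetSum _ fun k' _ => hint k k')]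
  simp_rw [integral_finsetSum _ fun k' _ => hint _ k', integral_const_mul,
    integral_cellN_prod_cellWave hL]
  rw [Finset.mul_sum]
  refine Finset.sum_congr rfl fun k _ => ?_
  rw [Finset.mul_sum]
  refine Finset.sum_congr rfl fun k' _ => ?_
  split_ifs <;> ring

end Source

/-! ### The one-excitation sector `A_t = X₀^{n+1} + t X₀ⁿX₁` on two modes `0 ↦ 0`, `1 ↦ e₁` -/

section Sector

/-- The unit lattice momentum `e₁ = (1,0,0)`. [folklore] -/
def e1 : Momentum := Pi.single 0 1

theorem e1_apply (j : Fin 3) : e1 j = if j = 0 then 1 else 0 := by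
  simp [e1, Pi.single_apply]

theorem e1_ne_zero : e1 ≠ 0 := by
  intro h
  have := congr_fun h 0
  simp [e1] at this

theorem two_e1_ne_zero : e1 + e1 ≠ 0 := by
  intro h
  have := congr_fun h 0
  simp [e1] at this

theorem two_e1_ne_e1 : e1 + e1 ≠ e1 := by
  intro h
  have := congr_fun h 0
  simp [e1] at this

/-- The momentum labels of the two modes: `0 ↦ 0` (condensate), `1 ↦ e₁`. [folklore] -/
def lab : Fin 2 → Momentum := ![0, e1]

@[simp] theorem lab_zero : lab 0 = 0 := rfl
@[simp] theorem lab_one : lab 1 = e1 := rfl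

theorem lab_eq_zero_iff (p : Fin 2) : lab p = 0 ↔ p = 0 := by
  fin_cases p
  · simp
  · simp [e1_ne_zero]

theorem lab_injective : Function.Injective lab := by
  intro p q h
  fin_cases p <;> fin_cases q
  · rfl
  · exact absurd h.symm e1_ne_zero
  · exact absurd h e1_ne_zero
  · rfl

variable (n : ℕ)

/-- The sector `A_t = X₀^{n+1} + t·X₀ⁿX₁` (all particles condensed, plus amplitude `t` for one
particle in the mode `e₁`). [folklore] -/
def sectorA (t : ℝ) : MvPolynomial (Fin 2) ℂ :=
  monomial (Finsupp.single 0 (n + 1)) 1 + monomial (Finsupp.single 0 n + Finsupp.single 1 1) (t : ℂ)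

variable {n}

theorem single_succ_ne : (Finsupp.single 0 (n + 1) : Fin 2 →₀ ℕ) ≠
    Finsupp.single 0 n + Finsupp.single 1 1 := by
  intro h
  have := DFunLike.congr_fun h 1
  simp at this

theorem degree_single_succ : (Finsupp.single (0 : Fin 2) (n + 1)).degree = n + 1 := by
  simp

theorem degree_single_add : (Finsupp.single (0 : Fin 2) n + Finsupp.single 1 1).degree = n + 1 := by
  simp [map_add]

theorem isHomogeneous_sectorA (t : ℝ) : (sectorA n t).IsHomogeneous (n + 1) :=
  (isHomogeneous_monomial _ degree_single_succ).add (isHomogeneous_monomial _ degree_single_add)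

theorem coeff_sectorA (t : ℝ) (d : Fin 2 →₀ ℕ) :
    coeff d (sectorA n t) = (if Finsupp.single 0 (n + 1) = d then 1 else 0) +
      (if Finsupp.single 0 n + Finsupp.single 1 1 = d then (t : ℂ) else 0) := by
  simp only [sectorA, coeff_add, coeff_monomial]

theorem sectorA_ne_zero (t : ℝ) : sectorA n t ≠ 0 := by
  intro h
  have h1 := congr_arg (coeff (Finsupp.single 0 (n + 1))) h
  rw [coeff_sectorA, if_pos rfl, if_neg single_succ_ne.symm, coeff_zero] at h1
  norm_num at h1

/-- `d! ` of the two configurations. [folklore] -/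
theorem occFactorial_single_succ : occFactorial (Finsupp.single (0 : Fin 2) (n + 1)) = (n + 1).factorial := by
  rw [occFactorial_eq_prod_of_subset _ (Finset.subset_univ _), Fin.prod_univ_two]
  simp

theorem occFactorial_single_add :
    occFactorial (Finsupp.single (0 : Fin 2) n + Finsupp.single 1 1) = n.factorial := by
  rw [occFactorial_eq_prod_of_subset _ (Finset.subset_univ _), Fin.prod_univ_two]
  simp

/-- `‖A_t‖² = (n+1)! + t² n!`. [folklore] -/
theorem fockInner_sectorA (t : ℝ) :
    fockInner (sectorA n t) (sectorA n t) = (((n + 1).factorial + t ^ 2 * n.factorial : ℝ) : ℂ) := by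
  classical
  unfold sectorA
  rw [fockInner_add_left, fockInner_add_right, fockInner_add_right, fockInner_monomial,
    fockInner_monomial, fockInner_monomial, fockInner_monomial, if_pos rfl, if_neg single_succ_ne,
    if_neg single_succ_ne.symm, if_pos rfl, occFactorial_single_succ, occFactorial_single_add]
  simp only [map_one, one_mul, Complex.conj_ofReal, add_zero, zero_add]
  push_cast
  ring

/-- `a_{e₁} A_t = t X₀ⁿ`. [folklore] -/
theorem pderiv_one_sectorA (t : ℝ) :
    pderiv 1 (sectorA n t) = monomial (Finsupp.single 0 n) (t : ℂ) := by
  unfold sectorA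
  rw [map_add, pderiv_monomial, pderiv_monomial]
  simp

/-- `‖a_{e₁}A_t‖² = t² n!`. [folklore] -/
theorem fockInner_pderiv_one_sectorA (t : ℝ) :
    fockInner (pderiv 1 (sectorA n t)) (pderiv 1 (sectorA n t)) = ((t ^ 2 * n.factorial : ℝ) : ℂ) := by
  classical
  rw [pderiv_one_sectorA, fockInner_monomial, if_pos rfl,
    occFactorial_eq_prod_of_subset _ (Finset.subset_univ _), Fin.prod_univ_two]
  have h1 : (Finsupp.single (0 : Fin 2) n) 1 = 0 := by simp
  rw [Finsupp.single_eq_same, h1, Nat.factorial_zero, mul_one, Complex.conj_ofReal]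
  push_cast
  ring

end Sector

/-! ### Words over two modes: counting letters, and the amplitude of `A_t` -/

section Words

variable {n : ℕ}

/-- Number of slots of a word in the excited mode. [folklore] -/
def ones (k : Fin (n + 1) → Fin 2) : ℕ := (Finset.univ.filter fun i => k i = 1).card

/-- Number of slots of a word in the condensate mode. [folklore] -/
def zeros (k : Fin (n + 1) → Fin 2) : ℕ := (Finset.univ.filter fun i => k i = 0).card

theorem fin_two_ne_zero_iff (p : Fin 2) : p ≠ 0 ↔ p = 1 := by
  fin_cases p <;> simp

theorem zeros_add_ones (k : Fin (n + 1) → Fin 2) : zeros k + ones k = n + 1 := by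
  unfold zeros ones
  have h : (Finset.univ.filter fun i => k i = 1) = Finset.univ.filter fun i => ¬ k i = 0 := by
    ext i; simp [fin_two_ne_zero_iff]
  rw [h, Finset.card_filter_add_card_filter_not, Finset.card_univ, Fintype.card_fin]

theorem ones_eq_zero_iff (k : Fin (n + 1) → Fin 2) : ones k = 0 ↔ k = fun _ => 0 := by
  unfold ones
  rw [Finset.card_eq_zero, Finset.filter_eq_empty_iff]
  constructor
  · intro h; funext i
    have hi := h (Finset.mem_univ i)
    by_contra h0
    exact hi ((fin_two_ne_zero_iff _).1 h0)
  · rintro rfl i _ h; simp at h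

theorem ones_const_zero : ones (fun _ : Fin (n + 1) => (0 : Fin 2)) = 0 :=
  (ones_eq_zero_iff _).2 rfl

theorem zeros_const_zero : zeros (fun _ : Fin (n + 1) => (0 : Fin 2)) = n + 1 := by
  have h := zeros_add_ones (fun _ : Fin (n + 1) => (0 : Fin 2))
  rw [ones_const_zero, add_zero] at h
  exact h

/-- Exciting slot `0` of a word condensed there adds one excited letter. [folklore] -/
theorem ones_update_zero {k : Fin (n + 1) → Fin 2} (h : k 0 = 0) :
    ones (Function.update k 0 1) = ones k + 1 := by
  unfold ones
  have hset : (Finset.univ.filter fun i => Function.update k 0 1 i = 1) =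
      insert 0 (Finset.univ.filter fun i => k i = 1) := by
    ext i
    simp only [Finset.mem_filter, Finset.mem_univ, true_and, Finset.mem_insert]
    by_cases hi : i = 0
    · subst hi; simp
    · rw [Function.update_of_ne hi]; simp [hi]
  rw [hset, Finset.card_insert_of_notMem]
  simp [h]

/-- The letter count of a word. [folklore] -/
theorem wordOcc_apply_eq_card (k : Fin (n + 1) → Fin 2) (p : Fin 2) :
    wordOcc k p = (Finset.univ.filter fun i => k i = p).card := by
  unfold wordOcc
  rw [Finsupp.finsetSum_apply, Finset.card_filter]
  refine Finset.sum_congr rfl fun i _ => ?_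
  rw [Finsupp.single_apply]

/-- The occupation configuration of a two-letter word. [folklore] -/
theorem wordOcc_fin_two (k : Fin (n + 1) → Fin 2) :
    wordOcc k = Finsupp.single 0 (zeros k) + Finsupp.single 1 (ones k) := by
  ext p
  rw [wordOcc_apply_eq_card]
  fin_cases p
  · simp [zeros]
  · simp [ones]

theorem single_pair_eq_iff (a b a' b' : ℕ) :
    (Finsupp.single (0 : Fin 2) a + Finsupp.single 1 b = Finsupp.single 0 a' + Finsupp.single 1 b') ↔
      a = a' ∧ b = b' := by
  constructor
  · intro h
    have h0 := DFunLike.congr_fun h 0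
    have h1 := DFunLike.congr_fun h 1
    simp at h0 h1
    exact ⟨h0, h1⟩
  · rintro ⟨rfl, rfl⟩; rfl

theorem occFactorial_pair (a b : ℕ) :
    occFactorial (Finsupp.single (0 : Fin 2) a + Finsupp.single 1 b) = a.factorial * b.factorial := by
  rw [occFactorial_eq_prod_of_subset _ (Finset.subset_univ _), Fin.prod_univ_two]
  simp

/-- **The amplitude of `A_t` on a word**: `√((n+1)!)` on the condensed word, `t·n!/√((n+1)!)` on the
words with exactly one excited letter, `0` otherwise. [folklore] -/
theorem amp_sectorA (t : ℝ) (k : Fin (n + 1) → Fin 2) :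
    amp (sectorA n t) (n + 1) k =
      if ones k = 0 then ((Real.sqrt ((n + 1).factorial : ℝ) : ℝ) : ℂ)
      else if ones k = 1 then
        (((Real.sqrt ((n + 1).factorial : ℝ))⁻¹ * n.factorial * t : ℝ) : ℂ)
      else 0 := by
  have hzo := zeros_add_ones k
  unfold amp
  rw [coeff_sectorA, wordOcc_fin_two, occFactorial_pair]
  have hA : (Finsupp.single (0 : Fin 2) (n + 1) = Finsupp.single 0 (zeros k) + Finsupp.single 1 (ones k)) ↔
      ones k = 0 := by
    rw [show (Finsupp.single (0 : Fin 2) (n + 1)) = Finsupp.single 0 (n + 1) + Finsupp.single 1 0 by simp,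
      single_pair_eq_iff]
    omega
  have hB : (Finsupp.single (0 : Fin 2) n + Finsupp.single 1 1 =
      Finsupp.single 0 (zeros k) + Finsupp.single 1 (ones k)) ↔ ones k = 1 := by
    rw [single_pair_eq_iff]
    omega
  by_cases h0 : ones k = 0
  · have hz : zeros k = n + 1 := by omega
    rw [if_pos (hA.2 h0), if_neg (fun h => by rw [hB] at h; omega), if_pos h0, hz, h0]
    simp only [Nat.factorial_zero, mul_one, add_zero]
    have hpos : (0 : ℝ) < ((n + 1).factorial : ℝ) := by positivity
    rw [show (((Real.sqrt ((n + 1).factorial : ℝ) : ℝ) : ℂ)) =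
      (((Real.sqrt ((n + 1).factorial : ℝ))⁻¹ * ((n + 1).factorial : ℝ) : ℝ) : ℂ) by
        rw [inv_mul_eq_div, Real.div_sqrt]]
    push_cast
    ring
  · by_cases h1 : ones k = 1
    · have hz : zeros k = n := by omega
      rw [if_neg (fun h => h0 (hA.1 h)), if_pos (hB.2 h1), if_neg h0, if_pos h1, hz, h1]
      simp only [Nat.factorial_one, mul_one, zero_add]
      push_cast
      ring
    · rw [if_neg (fun h => h0 (hA.1 h)), if_neg (fun h => h1 (hB.1 h)), if_neg h0, if_neg h1]
      simp

end Words

/-! ### The source double sum for `ψ = c·Ψ_{A_t}` -/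

section SourceSum

variable {n : ℕ}

theorem fin_two_cases (p : Fin 2) : p = 0 ∨ p = 1 := by
  fin_cases p <;> simp

/-- The orthogonality constraint of the source integral for the labelling `lab` with the extra
wave `e₁` in slot `0`: the bra word is the ket word with slot `0` excited, and the ket word is
condensed in slot `0`. [folklore] -/
theorem cond_iff (k k' : Fin (n + 1) → Fin 2) :
    ((fun i => lab (k' i) - lab (k i) + (if i = (0 : Fin (n + 1)) then e1 else 0)) = 0) ↔
      (k = Function.update k' 0 1 ∧ k' 0 = 0) := by
  constructor
  · intro h
    have h0 := congr_fun h 0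
    simp only [if_true, Pi.zero_apply] at h0
    have hi : ∀ i, i ≠ 0 → k i = k' i := by
      intro i hi
      have := congr_fun h i
      simp only [if_neg hi, add_zero, Pi.zero_apply, sub_eq_zero] at this
      exact (lab_injective this).symm
    have hk : k' 0 = 0 ∧ k 0 = 1 := by
      rcases fin_two_cases (k' 0) with h1 | h1 <;> rcases fin_two_cases (k 0) with h2 | h2 <;>
        rw [h1, h2] at h0 <;> simp only [lab_zero, lab_one, sub_zero, zero_add, sub_self, zero_sub,
          neg_add_cancel] at h0
      · exact absurd h0 e1_ne_zero
      · exact ⟨h1, h2⟩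
      · exact absurd h0 two_e1_ne_zero
      · exact absurd (by simpa using h0) e1_ne_zero
    refine ⟨?_, hk.1⟩
    funext i
    by_cases hi0 : i = 0
    · subst hi0; rw [Function.update_self]; exact hk.2
    · rw [Function.update_of_ne hi0]; exact hi i hi0
  · rintro ⟨rfl, h0⟩
    funext i
    by_cases hi0 : i = 0
    · subst hi0
      simp [h0]
    · rw [Function.update_of_ne hi0]
      simp [hi0]

/-- The coefficients of `ψ = c·Ψ_{A_t}` as a word sum. [folklore] -/
def aCoef (n : ℕ) (t c : ℝ) (k : Fin (n + 1) → Fin 2) : ℂ := (c : ℂ) * amp (sectorA n t) (n + 1) k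

/-- The coefficients of `Θ = P₀ n̂₀^{-1/2} ψ` as a word sum (`theta_wordSum`). [folklore] -/
def bCoef (n : ℕ) (t c : ℝ) (k : Fin (n + 1) → Fin 2) : ℂ :=
  if lab (k 0) = 0 then ((Real.sqrt ((zeroSlots lab k).card : ℝ))⁻¹ : ℂ) * aCoef n t c k else 0

theorem card_zeroSlots_lab (k : Fin (n + 1) → Fin 2) : (zeroSlots lab k).card = zeros k := by
  unfold zeroSlots zeros
  congr 1
  ext i
  simp [lab_eq_zero_iff]

/-- **The source double sum has exactly one non-zero term** (ket word condensed, bra word with slot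
`0` excited): `∑_{k,k'} conj(a_k) b_{k'} [constraint] = c² t n! (n+1)^{-1/2}`. [folklore] -/
theorem source_double_sum (t c : ℝ) :
    ∑ k : Fin (n + 1) → Fin 2, ∑ k' : Fin (n + 1) → Fin 2, conj (aCoef n t c k) * bCoef n t c k' *
        (if (fun i => lab (k' i) - lab (k i) + (if i = (0 : Fin (n + 1)) then e1 else 0)) = 0
          then 1 else 0) =
      ((c ^ 2 * t * n.factorial * (Real.sqrt ((n : ℝ) + 1))⁻¹ : ℝ) : ℂ) := by
  classical
  simp only [cond_iff]
  rw [Finset.sum_comm]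
  have h1 : ∀ k' : Fin (n + 1) → Fin 2,
      ∑ k : Fin (n + 1) → Fin 2, conj (aCoef n t c k) * bCoef n t c k' *
        (if (k = Function.update k' 0 1 ∧ k' 0 = 0) then 1 else 0) =
      if k' 0 = 0 then conj (aCoef n t c (Function.update k' 0 1)) * bCoef n t c k' else 0 := by
    intro k'
    by_cases h0 : k' 0 = 0
    · simp only [h0, and_true, if_true]
      rw [Finset.sum_eq_single (Function.update k' 0 1)]
      · simp
      · intro k _ hk; simp [hk]
      · intro h; exact absurd (Finset.mem_univ _) h
    · simp [h0]
  simp only [h1]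
  rw [Finset.sum_eq_single (fun _ => (0 : Fin 2))]
  · -- the surviving term
    have hu : ones (Function.update (fun _ : Fin (n + 1) => (0 : Fin 2)) 0 1) = 1 := by
      rw [ones_update_zero rfl, ones_const_zero]
    have hz : ((zeroSlots lab (fun _ : Fin (n + 1) => (0 : Fin 2))).card : ℝ) = (n : ℝ) + 1 := by
      rw [card_zeroSlots_lab, zeros_const_zero]; push_cast; ring
    simp only [if_true, bCoef, aCoef, lab_zero, amp_sectorA, hu, ones_const_zero, one_ne_zero,
      if_false, hz, map_mul, Complex.conj_ofReal]
    have hs : Real.sqrt ((n + 1).factorial : ℝ) ≠ 0 :=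
      Real.sqrt_ne_zero'.2 (by positivity)
    norm_cast
    rw [show c * ((Real.sqrt ((n + 1).factorial : ℝ))⁻¹ * (n.factorial : ℝ) * t) *
        ((Real.sqrt ((n + 1 : ℕ) : ℝ))⁻¹ * (c * Real.sqrt ((n + 1).factorial : ℝ))) =
        c ^ 2 * t * n.factorial * (Real.sqrt ((n + 1 : ℕ) : ℝ))⁻¹ *
          ((Real.sqrt ((n + 1).factorial : ℝ))⁻¹ * Real.sqrt ((n + 1).factorial : ℝ)) by ring,
      inv_mul_cancel₀ hs, mul_one]
  · intro k' _ hk'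
    by_cases h0 : k' 0 = 0
    · rw [if_pos h0]
      have hpos : ones k' ≠ 0 := fun h => hk' ((ones_eq_zero_iff k').1 h)
      have h2 : ones (Function.update k' 0 1) ≠ 0 ∧ ones (Function.update k' 0 1) ≠ 1 := by
        rw [ones_update_zero h0]; omega
      simp [aCoef, amp_sectorA, h2.1, h2.2]
    · rw [if_neg h0]
  · intro h; exact absurd (Finset.mem_univ _) h

end SourceSum

/-! ### Assembly: the trial state, its energy, its source, and the sharpness of `C = 1/(4π²)` -/

section Assembly

variable {n : ℕ} {L : ℝ}

/-- The normalisation constant of `Ψ_{A_t}/‖Ψ_{A_t}‖`. [folklore] -/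
def cNorm (n : ℕ) (t L : ℝ) : ℝ :=
  (Real.sqrt ((L ^ 3) ^ (n + 1) * ((n + 1).factorial + t ^ 2 * n.factorial)))⁻¹

theorem fockInner_sectorA_re (t : ℝ) :
    (fockInner (sectorA n t) (sectorA n t)).re = (n + 1).factorial + t ^ 2 * n.factorial := by
  rw [fockInner_sectorA, Complex.ofReal_re]

/-- The one-excitation superposition `Φ_t = Ψ_{A_t}/‖Ψ_{A_t}‖` as a periodic trial state
(tree: `Fock.sectorTrialState`). [folklore] -/
def trialΦ (n : ℕ) (t : ℝ) (hL : 0 < L) : PeriodicTrialState (n + 1) L :=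
  sectorTrialState hL lab_injective (isHomogeneous_sectorA (n := n) t) (sectorA_ne_zero t)

theorem trialΦ_ψ (t : ℝ) (hL : 0 < L) :
    (trialΦ n t hL).ψ = wordSum L lab (aCoef n t (cNorm n t L)) := by
  funext X
  rw [trialΦ, sectorTrialState_ψ, fockInner_sectorA_re]
  unfold wordSum aCoef sectorWave cNorm
  rw [Finset.mul_sum]
  refine Finset.sum_congr rfl fun k _ => ?_
  ring

theorem sum_e1_sq : (∑ j : Fin 3, ((e1 j : ℤ) : ℝ) ^ 2) = 1 := by
  simp [e1_apply]

theorem norm_waveVector_e1_sq (L : ℝ) : ‖waveVector L e1‖ ^ 2 = 4 * Real.pi ^ 2 / L ^ 2 := by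
  rw [norm_waveVector_sq, sum_e1_sq, mul_one]

/-- **The energy of `Φ_t` at `v = 0`**: `E(Φ_t) = (4π²/L²)·t²n!/((n+1)! + t²n!)`. [folklore] -/
theorem periodicEnergy_trialΦ (t : ℝ) (hL : 0 < L) :
    periodicEnergy 0 (trialΦ n t hL) =
      ENNReal.ofReal ((4 * Real.pi ^ 2 / L ^ 2 * (t ^ 2 * n.factorial)) /
        ((n + 1).factorial + t ^ 2 * n.factorial)) := by
  unfold periodicEnergy
  have h0 : ∀ X, kineticDensity (trialΦ n t hL).ψ X +
      periodicInteraction 0 L X * ((‖(trialΦ n t hL).ψ X‖₊ : ℝ≥0∞)) ^ 2 =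
      kineticDensity (trialΦ n t hL).ψ X := by
    intro X; rw [periodicInteraction_zero, zero_mul, add_zero]
  simp only [h0]
  rw [trialΦ, lintegral_kineticDensity_sectorTrialState hL lab_injective (isHomogeneous_sectorA t)
    (sectorA_ne_zero t), fockInner_sectorA_re, Fin.sum_univ_two, lab_zero, lab_one, waveVector_zero,
    norm_zero, fockInner_pderiv_one_sectorA, norm_waveVector_e1_sq, Complex.ofReal_re]
  congr 1
  ring

/-- The phase of the crux's source is the plane wave `e_{e₁}(x₀)`. [folklore] -/
theorem exp_phase_eq_cellWave (L : ℝ) (X : Config (n + 1)) :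
    Complex.exp (Complex.I * ↑(2 * Real.pi / L * ∑ j, ((e1 j : ℤ) : ℝ) * X 0 j)) =
      cellWave L e1 (X 0) := by
  rw [cellWave_apply]
  congr 1
  push_cast
  ring

/-- **The source integral of `Φ_t`** (the crux's `∫ conj(Φ) e^{ik·x₀} Θ` with `Θ = ∑_{S∋0}|S|^{-1/2}Q_SΦ`):
`= L^{3(n+1)} c² t n! (n+1)^{-1/2}`. [folklore] -/
theorem source_integral_trialΦ (t : ℝ) (hL : 0 < L) :
    ∫ X in cellN (n + 1) L, conj ((trialΦ n t hL).ψ X) *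
        Complex.exp (Complex.I * ↑(2 * Real.pi / L * ∑ j, ((e1 j : ℤ) : ℝ) * X 0 j)) *
        (∑ S ∈ (Finset.univ : Finset (Finset (Fin (n + 1)))).filter (fun S => (0 : Fin (n + 1)) ∈ S),
          ((Real.sqrt (S.card : ℝ))⁻¹ : ℂ) *
            (List.finRange (n + 1)).foldr
              (fun i h => if i ∈ S then cellAvg L i h else h - cellAvg L i h) (trialΦ n t hL).ψ X) =
      ((L : ℂ) ^ 3) ^ (n + 1) *
        (((cNorm n t L) ^ 2 * t * n.factorial * (Real.sqrt ((n : ℝ) + 1))⁻¹ : ℝ) : ℂ) := by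
  simp only [exp_phase_eq_cellWave, trialΦ_ψ, theta_wordSum hL]
  have hb : (fun k : Fin (n + 1) → Fin 2 => if lab (k 0) = 0 then
      ((Real.sqrt ((zeroSlots lab k).card : ℝ))⁻¹ : ℂ) * aCoef n t (cNorm n t L) k else 0) =
      bCoef n t (cNorm n t L) := rfl
  rw [hb, integral_cellN_conj_wordSum_wave_wordSum hL lab e1 0, source_double_sum]

/-- `c² L^{3(n+1)} = 1/((n+1)! + t² n!)`. [folklore] -/
theorem cNorm_sq_mul (t : ℝ) (hL : 0 < L) :
    (cNorm n t L) ^ 2 * (L ^ 3) ^ (n + 1) = ((n + 1).factorial + t ^ 2 * n.factorial)⁻¹ := by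
  unfold cNorm
  have h1 : (0 : ℝ) < (L ^ 3) ^ (n + 1) := by positivity
  have h2 : (0 : ℝ) < (n + 1).factorial + t ^ 2 * n.factorial := by positivity
  rw [inv_pow, Real.sq_sqrt (by positivity)]
  field_simp

/-- **The norm of the source integral of `Φ_t`**: `|t| n!/(((n+1)! + t²n!)√(n+1))`. [folklore] -/
theorem norm_source_integral_trialΦ (t : ℝ) (hL : 0 < L) :
    ‖∫ X in cellN (n + 1) L, conj ((trialΦ n t hL).ψ X) *
        Complex.exp (Complex.I * ↑(2 * Real.pi / L * ∑ j, ((e1 j : ℤ) : ℝ) * X 0 j)) *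
        (∑ S ∈ (Finset.univ : Finset (Finset (Fin (n + 1)))).filter (fun S => (0 : Fin (n + 1)) ∈ S),
          ((Real.sqrt (S.card : ℝ))⁻¹ : ℂ) *
            (List.finRange (n + 1)).foldr
              (fun i h => if i ∈ S then cellAvg L i h else h - cellAvg L i h) (trialΦ n t hL).ψ X)‖ =
      |t| * n.factorial / (((n + 1).factorial + t ^ 2 * n.factorial) * Real.sqrt ((n : ℝ) + 1)) := by
  rw [source_integral_trialΦ, norm_mul, Complex.norm_real, norm_pow, norm_pow, Complex.norm_real,
    Real.norm_of_nonneg hL.le]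
  have h2 : (0 : ℝ) < (n + 1).factorial + t ^ 2 * n.factorial := by positivity
  have h3 : (0 : ℝ) < Real.sqrt ((n : ℝ) + 1) := Real.sqrt_pos.2 (by positivity)
  rw [Real.norm_eq_abs, show (cNorm n t L) ^ 2 * t * n.factorial * (Real.sqrt ((n : ℝ) + 1))⁻¹ =
    t * ((cNorm n t L) ^ 2 * n.factorial * (Real.sqrt ((n : ℝ) + 1))⁻¹) by ring, abs_mul,
    abs_of_nonneg (by positivity : (0 : ℝ) ≤ (cNorm n t L) ^ 2 * n.factorial * (Real.sqrt ((n : ℝ) + 1))⁻¹)]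
  rw [show (L ^ 3) ^ (n + 1) * (|t| * ((cNorm n t L) ^ 2 * n.factorial * (Real.sqrt ((n : ℝ) + 1))⁻¹)) =
    |t| * n.factorial * (Real.sqrt ((n : ℝ) + 1))⁻¹ * ((cNorm n t L) ^ 2 * (L ^ 3) ^ (n + 1)) by ring,
    cNorm_sq_mul t hL]
  field_simp

/-- The sup norm of `e₁` cast to `ℝ³` is `1`. [folklore] -/
theorem norm_e1_cast : ‖(fun j => ((e1 j : ℤ) : ℝ))‖ = 1 := by
  apply le_antisymm
  · refine (pi_norm_le_iff_of_nonneg zero_le_one).2 fun j => ?_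
    rw [e1_apply]
    split_ifs <;> simp
  · have h := norm_le_pi_norm (fun j => ((e1 j : ℤ) : ℝ)) 0
    simpa [e1_apply] using h

/-- The body of canonical Gaussian domination at fixed window `M`, constant `C`, density ceiling
`ρ₀` and threshold `N₀` (verbatim the part of the crux after `∃ N₀`). [this route, crux 9479] -/
def GDBody (v : ℝ → ℝ≥0∞) (M C ρ₀ : ℝ) (N₀ : ℕ) : Prop :=
  ∀ m : ℕ, N₀ ≤ m + 1 → ∀ L : ℝ, 0 < L → ((m + 1 : ℕ) : ℝ) ≤ ρ₀ * L ^ 3 → ∀ n : Fin 3 → ℤ, n ≠ 0 → 2 * Real.pi * ‖(fun j => (n j : ℝ))‖ / L ≤ M * Real.sqrt ((m + 1 : ℕ) / L ^ 3) → ∀ s : ℝ, 0 ≤ s → ∀ Φ : Literature.MathematicalPhysics.QuantumManyBody.BoseGas.PeriodicTrialState (m + 1) L, let P : Fin (m + 1) → (Literature.MathematicalPhysics.QuantumManyBody.BoseGas.Config (m + 1) → ℂ) → (Literature.MathematicalPhysics.QuantumManyBody.BoseGas.Config (m + 1) → ℂ) := fun i g X => ((L ^ 3)⁻¹ : ℝ)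 • ∫ y in Literature.MathematicalPhysics.QuantumManyBody.BoseGas.cell L, g (Function.update X i y); let Q : Finset (Fin (m + 1)) → (Literature.MathematicalPhysics.QuantumManyBody.BoseGas.Config (m + 1) → ℂ) → (Literature.MathematicalPhysics.QuantumManyBody.BoseGas.Config (m + 1) → ℂ) := fun S g => (List.finRange (m + 1)).foldr (fun i h => if i ∈ S then P i h else h - P i h) g; let Θ : Literature.MathematicalPhysics.QuantumManyBody.BoseGas.Config (m + 1) → ℂ := fun X => ∑ S ∈ (Finset.univ : Finset (Finset (Fin (m + 1)))).filter (fun S => (0 : Fin (m + 1)) ∈ S), ((Real.sqrt (S.card : ℝ))⁻¹ : ℂ) * Q S Φ.ψ X; Literature.MathematicalPhysics.QuantumManyBody.BoseGas.periodicGroundStateEnergy v (m + 1) L + ENNReal.ofReal (s * (2 * (m + 1) * ‖∫ X in Literature.MathematicalPhysics.QuantumManyBody.BoseGas.cellN (m + 1) L, (starRingEnd ℂ) (Φ.ψ X) * Complex.exp (Complex.I * ↑(2 * Real.pi / L * ∑ j, (n j : ℝ) * X 0 j)) * Θ X‖)) ≤ Literature.MathematicalPhysics.QuantumManyBody.BoseGas.periodicEnergy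 v Φ + ENNReal.ofReal (C * s ^ 2 * L ^ 2 / ‖(fun j => (n j : ℝ))‖ ^ 2)

/-- `GDCanAtWith` is the body for every window, with `ρ₀, N₀` depending on the window.
[this route] -/
theorem gdCanAtWith_iff (v : ℝ → ℝ≥0∞) (C : ℝ) :
    GDCanAtWith v C ↔ ∀ M : ℝ, 0 < M → ∃ ρ₀ : ℝ, 0 < ρ₀ ∧ ∃ N₀ : ℕ, GDBody v M C ρ₀ N₀ :=
  Iff.rfl


end Assembly

/-! ### The sharpness theorem -/

section Final

/-- Monotonicity of the fixed-window body in the constant. [folklore] -/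
theorem gdBody_mono {v : ℝ → ℝ≥0∞} {M C C' ρ₀ : ℝ} {N₀ : ℕ} (hCC' : C ≤ C')
    (h : GDBody v M C ρ₀ N₀) : GDBody v M C' ρ₀ N₀ := by
  intro m hm L hL hd nv hnv hw s hs Φ
  have key := h m hm L hL hd nv hnv hw s hs Φ
  dsimp only at key ⊢
  exact key.trans (by gcongr)

/-- The real arithmetic of the sharpness proof, on atomic variables (`nr = n+1`, `nf = n!`).
[folklore] -/
theorem sharp_arith {C δ ε L nr nf t s : ℝ} (hC0 : 0 < C) (hδ : δ = 1 - 4 * Real.pi ^ 2 * C)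
    (hδ0 : 0 < δ) (hε2 : ε ^ 2 = δ / 2) (hε0 : 0 < ε) (hL : 0 < L) (hnr : 0 < nr) (hnf : 0 < nf)
    (ht : t = ε * Real.sqrt nr) (hs : s = ε / (C * L ^ 2 * (1 + ε ^ 2)))
    (key : s * (2 * nr * (|t| * nf / ((nr * nf + t ^ 2 * nf) * Real.sqrt nr))) ≤
      4 * Real.pi ^ 2 / L ^ 2 * (t ^ 2 * nf) / (nr * nf + t ^ 2 * nf) + C * s ^ 2 * L ^ 2) : False := by
  have hsq : 0 < Real.sqrt nr := Real.sqrt_pos.2 hnr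
  have ht0 : 0 < t := by rw [ht]; exact mul_pos hε0 hsq
  have ht2 : t ^ 2 = ε ^ 2 * nr := by rw [ht, mul_pow, Real.sq_sqrt hnr.le]
  have hε1 : (0 : ℝ) < 1 + ε ^ 2 := by positivity
  have hF : nr * nf + t ^ 2 * nf = nr * nf * (1 + ε ^ 2) := by rw [ht2]; ring
  have h_src : s * (2 * nr * (|t| * nf / ((nr * nf + t ^ 2 * nf) * Real.sqrt nr))) =
      2 * s * ε / (1 + ε ^ 2) := by
    rw [abs_of_pos ht0, hF, ht]
    field_simp
  have h_kin : 4 * Real.pi ^ 2 / L ^ 2 * (t ^ 2 * nf) / (nr * nf + t ^ 2 * nf) =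
      4 * Real.pi ^ 2 * ε ^ 2 / (L ^ 2 * (1 + ε ^ 2)) := by
    rw [hF, ht2]
    field_simp
  rw [h_src, h_kin] at key
  have h_lhs : 2 * s * ε / (1 + ε ^ 2) = 2 * (ε ^ 2 / (C * L ^ 2 * (1 + ε ^ 2) ^ 2)) := by
    rw [hs]; field_simp
  have h_pen : C * s ^ 2 * L ^ 2 = ε ^ 2 / (C * L ^ 2 * (1 + ε ^ 2) ^ 2) := by
    rw [hs]; field_simp
  rw [h_lhs, h_pen] at key
  have h3 : ε ^ 2 / (C * L ^ 2 * (1 + ε ^ 2) ^ 2) ≤ 4 * Real.pi ^ 2 * ε ^ 2 / (L ^ 2 * (1 + ε ^ 2)) := by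
    linarith
  rw [div_le_div_iff₀ (by positivity) (by positivity)] at h3
  have hpos : 0 < ε ^ 2 * L ^ 2 * (1 + ε ^ 2) := by positivity
  have h5 : ε ^ 2 * L ^ 2 * (1 + ε ^ 2) * 1 ≤
      ε ^ 2 * L ^ 2 * (1 + ε ^ 2) * (4 * Real.pi ^ 2 * C * (1 + ε ^ 2)) := by
    have h4 := h3
    ring_nf at h4 ⊢
    linarith
  have h6 := le_of_mul_le_mul_left h5 hpos
  rw [hε2] at h6
  nlinarith [h6, hδ0, hδ, mul_pos hδ0 hδ0, mul_pos hC0 hδ0]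

/-- **The free value `C = 1/(4π²)` of canonical Gaussian domination is sharp at every window**
(core case `0 < C < 1/(4π²)`): for `v = 0`, any `M, ρ₀ > 0` and `N₀`, the one-excitation
superposition `Φ_t`, `t = ε√(n+1)`, `ε² = (1 - 4π²C)/2`, on the torus of side
`L = M²(n+1)/(4π²)` (window mode `n = e₁`), `n` large, with `s = ε/(CL²(1+ε²))` violates the chord
inequality. [folklore] -/
theorem gdBody_zero_false_of_pos {M C ρ₀ : ℝ} {N₀ : ℕ} (hM : 0 < M) (hρ₀ : 0 < ρ₀) (hC0 : 0 < C)
    (hC : C < 1 / (4 * Real.pi ^ 2)) : ¬ GDBody 0 M C ρ₀ N₀ := by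
  intro h
  have hpi : 0 < 4 * Real.pi ^ 2 := by positivity
  -- the particle number
  set K : ℝ := (4 * Real.pi ^ 2) ^ 3 / (ρ₀ * M ^ 6) with hK
  have hKpos : 0 < K := by positivity
  set n : ℕ := N₀ + ⌈K⌉₊ with hn
  have hN : N₀ ≤ n + 1 := by omega
  have hnK : K ≤ (n : ℝ) + 1 := by
    have h1 := Nat.le_ceil K
    have h2 : ((⌈K⌉₊ : ℕ) : ℝ) ≤ n := by rw [hn]; push_cast; linarith
    linarith
  -- the box
  set L : ℝ := M ^ 2 * ((n : ℝ) + 1) / (4 * Real.pi ^ 2) with hL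
  have hLpos : 0 < L := by positivity
  have hnL : (n : ℝ) + 1 = 4 * Real.pi ^ 2 * L / M ^ 2 := by rw [hL]; field_simp
  have hdens : ((n + 1 : ℕ) : ℝ) ≤ ρ₀ * L ^ 3 := by
    push_cast
    rw [show ρ₀ * L ^ 3 = ((n : ℝ) + 1) ^ 3 / K by rw [hL, hK]; field_simp]
    rw [le_div_iff₀ hKpos]
    have h1 : (1 : ℝ) ≤ (n : ℝ) + 1 := by linarith [n.cast_nonneg (α := ℝ)]
    nlinarith [mul_le_mul hnK h1 zero_le_one (by linarith), sq_nonneg ((n : ℝ) + 1)]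
  have hwin : 2 * Real.pi * ‖(fun j => ((e1 j : ℤ) : ℝ))‖ / L ≤
      M * Real.sqrt (((n + 1 : ℕ) : ℝ) / L ^ 3) := by
    rw [norm_e1_cast, mul_one]
    have h1 : 2 * Real.pi / L = M * (2 * Real.pi / (L * M)) := by field_simp
    rw [h1]
    refine mul_le_mul_of_nonneg_left ?_ hM.le
    rw [Real.le_sqrt' (by positivity)]
    push_cast
    rw [hnL, div_pow, div_div, div_le_div_iff₀ (by positivity) (by positivity)]
    nlinarith [hLpos, hM]
  -- the amplitudes
  set δ : ℝ := 1 - 4 * Real.pi ^ 2 * C with hδ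
  have hδ0 : 0 < δ := by
    rw [hδ, sub_pos, ← lt_div_iff₀' hpi]; exact hC
  set ε : ℝ := Real.sqrt (δ / 2) with hε
  have hε0 : 0 < ε := Real.sqrt_pos.2 (by positivity)
  have hε2 : ε ^ 2 = δ / 2 := Real.sq_sqrt (by positivity)
  set t : ℝ := ε * Real.sqrt ((n : ℝ) + 1) with ht
  set s : ℝ := ε / (C * L ^ 2 * (1 + ε ^ 2)) with hs
  have hs0 : 0 < s := by positivity
  -- the chord inequality at Φ_t
  have key := h n hN L hLpos hdens e1 e1_ne_zero hwin s hs0.le (trialΦ n t hLpos)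
  dsimp only at key
  have hsrc := norm_source_integral_trialΦ (n := n) t hLpos
  unfold cellAvg at hsrc
  rw [hsrc, periodicGroundStateEnergy_zero_eq_zero (n + 1) hLpos, periodicEnergy_trialΦ,
    norm_e1_cast, zero_add, one_pow, div_one,
    ← ENNReal.ofReal_add (by positivity) (by positivity),
    ENNReal.ofReal_le_ofReal_iff (by positivity)] at key
  have hfac : (((n + 1).factorial : ℕ) : ℝ) = ((n : ℝ) + 1) * (n.factorial : ℝ) := by
    rw [Nat.factorial_succ]; push_cast; ring
  rw [hfac] at key
  exact sharp_arith hC0 hδ hδ0 hε2 hε0 hLpos (by positivity) (by positivity) ht hs key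

/-- **Sharpness at every window, all `C < 1/(4π²)`** (non-positive `C` by monotonicity). [folklore] -/
theorem gdBody_zero_false {M C ρ₀ : ℝ} {N₀ : ℕ} (hM : 0 < M) (hρ₀ : 0 < ρ₀)
    (hC : C < 1 / (4 * Real.pi ^ 2)) : ¬ GDBody 0 M C ρ₀ N₀ := by
  intro h
  have h8 : 0 < 1 / (8 * Real.pi ^ 2) := by positivity
  have h84 : 1 / (8 * Real.pi ^ 2) < 1 / (4 * Real.pi ^ 2) :=
    one_div_lt_one_div_of_lt (by positivity) (by nlinarith [Real.pi_pos])
  exact gdBody_zero_false_of_pos hM hρ₀ (lt_max_of_lt_right h8) (max_lt hC h84)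
    (gdBody_mono (le_max_left C (1 / (8 * Real.pi ^ 2))) h)

/-- **The fixed-constant strengthening of crux 9479 is false at `v = 0` for every `C < 1/(4π²)`.**
[folklore] -/
theorem gdCanAtWith_zero_false {C : ℝ} (hC : C < 1 / (4 * Real.pi ^ 2)) : ¬ GDCanAtWith 0 C := by
  intro h
  obtain ⟨ρ₀, hρ₀, N₀, h⟩ := h 1 one_pos
  exact gdBody_zero_false one_pos hρ₀ hC h

/-- **Any constant witnessing canonical Gaussian domination for the free gas is `≥ 1/(4π²)`**, at every
window `M`: the free (displaced-oscillator) value cannot be improved. [folklore] -/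
theorem free_constant_ge {M ρ₀ C : ℝ} {N₀ : ℕ} (hM : 0 < M) (hρ₀ : 0 < ρ₀)
    (h : GDBody 0 M C ρ₀ N₀) : 1 / (4 * Real.pi ^ 2) ≤ C :=
  not_lt.1 fun hC => gdBody_zero_false hM hρ₀ hC h

end Final

/-- **Corollary for crux 9479 as typed**: whatever constants `GaussianDominationCan` provides for the
free gas, they are `≥ 1/(4π²)` at every window. [folklore] -/
theorem gaussianDominationCan_free_constant_ge (h : GaussianDominationCan) {M : ℝ} (hM : 0 < M) :
    ∃ ρ₀ C : ℝ, 0 < ρ₀ ∧ 1 / (4 * Real.pi ^ 2) ≤ C ∧ ∃ N₀ : ℕ, GDBody 0 M C ρ₀ N₀ := by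
  obtain ⟨ρ₀, C, hρ₀, -, N₀, hb⟩ := h 0 isRepulsiveFiniteRange_zero M hM
  exact ⟨ρ₀, C, hρ₀, free_constant_ge hM hρ₀ hb, N₀, hb⟩

/-- The pointwise antecedent at `v = 0` with a uniform constant below the free value is refuted; with
`C ≥ 1/(4π²)` it is the displaced-oscillator bound (checked by hand in the route reviews, not here).
[folklore] -/
theorem not_gdCanAtWith_zero_of_lt {C : ℝ} (hC : C < 1 / (4 * Real.pi ^ 2)) : ¬ GDCanAtWith 0 C :=
  gdCanAtWith_zero_false hC

/-! ## §7 Toy: the 3-mode `(0, ±k)` contact gas with the LNSS source (exact diagonalisation + mean field)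

Model (units `k = 1`): `H = k²(n₊+n₋) + (U/2)[n₀(n₀-1) + n₊(n₊-1) + n₋(n₋-1) + 4n₀n₊ + 4n₀n₋ + 4n₊n₋
+ 2(a₀†a₀†a₊a₋ + h.c.)]`, `U = g/N` (Bogoliubov limit `e_k = √(k⁴+2gk²)`, `g ↔ 8πρa`), source
`B = Λ₊ + Λ₊†`, `Λ₊† = a₊†a₀n̂₀^{-1/2}` (acts as `b†` with the `n₀` factor cancelled; `Λ†Λ = n₊`).
Chord ratio `R(s) = k²(E₀ - E₀(s))/s²`, `E₀(s) = inf spec(H - sB)`; the crux's constant at `n = e₁` is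
`C ≥ sup_s R/(4π²)`.

EXACT DIAGONALISATION (kit job j006320, script `toy3mode.py`, cmp-6, 2026-08-16; the larger sweep
j006572 `N ≤ 140`, `g ∈ {0,½,2,10,50}` was still queued when this was written — its JSON attaches to
the item automatically):

  N    g   R(0)=χ/2  Bog (1+g)/(1+2g)  sup_s R  s@sup/√N   n_k   ‖ζ‖²  c/‖ζ‖²  √(bc)/‖ζ‖²
  6   0.0   1.0000        1.0000       1.0000    (flat)   0.000  1.000  1.000     1.000
 10   0.0   1.0000        1.0000       1.0000    (flat)   0.000  1.000  1.000     1.000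
 20   0.0   1.0000        1.0000       1.0000    (flat)   0.000  1.000  1.000     1.000
  6   2.0   0.5431        0.6000       0.5630    1.000    0.133  1.265  2.338     1.020
 10   2.0   0.5575        0.6000       0.6157    1.334    0.144  1.288  2.314     1.052
 20   2.0   0.5744        0.6000       0.6973    1.334    0.155  1.311  2.283     1.102

`R(s)` is flat at `χ/2` for `s ≲ 0.3√N`, has a bump at `s ≈ √N k²` growing with `N`, then decays
(`R ≈ (2σ-1)/σ²`-like). KLS is tight at `g = 0` (slack `1.000`) and within 10% at `g = 2`;
`c/‖ζ‖² ≈ k² + 0.65g` (the route's `c_k ≲ 2(k² + C'ρ)` shape).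

MEAN-FIELD LIMIT (`N → ∞` at fixed `g`, `s = σ√N k²`; `mf3mode.py`, run locally, pure Python):
`E(σ)/N = min_{x₊,x₋,φ} [x₊ + x₋ + (g/2)Q - 2σ√x₊]`,
`Q = x₀²+x₊²+x₋²+4x₀x₊+4x₀x₋+4x₊x₋+4x₀√(x₊x₋)cos φ`, `E₀/N = g/2`:

  g      R(σ→0)   (1+g)/(1+2g)   sup_σ R   argmax
  0.0    1.0000      1.0000      1.0000    σ ≤ 1 (all)
  0.5    0.7500      0.7500      1.0000    σ = 1, x₊ = 1
  2.0    0.6000      0.6000      1.0000    σ = 1, x₊ = 1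
 10.0    0.5237      0.5238      1.0000    σ = 1, x₊ = 1
 50.0    0.5046      0.5050      1.0000    σ = 1, x₊ = 1

FINDINGS. (i) The `s → 0` end of the chord is the Bogoliubov phase susceptibility `(1+g)/(1+2g) ∈
(½, 1]` — mean field reproduces it to 4 digits, exact diagonalisation converges to it. (ii) The
SUPREMUM over `s` is NOT attained at `s → 0` but at `s = √N k²` by FULL TRANSFER of the condensate
into the mode `k` (`x₊ = 1`: same interaction energy `(g/2)N` as the ground condensate, kinetic cost
`Nk²`, source `2s√N`), where `R = 1` = the FREE value, for every `g`; finite `N` approaches it from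
below (0.56 → 0.62 → 0.70). So in the toy the `∀ s` chord form never exceeds the free constant
(no blow-up from the nonlinear regime — good for the plausibility of crux 9479 as typed), but its
constant is pinned at the free value `1/(4π²)` by a state carrying no stiffness information: `C` of
`GaussianDominationCan` is an `O(1)` bookkeeping constant (all the KLS transfer needs), not a measure
of `ρ_s`; the physics (stiffness `< free`) sits in `R(s)` for `s ≪ √N k²`, which the chord form with
the free constant does not resolve. (iii) For the real gas the analogue of (ii) is the coherent
transfer family `((√(1-x) + √x e^{ik·x})^{⊗N})`: Hartree penalty `∝ x(1-x)` vanishing at both ends,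
so at mean-field level `sup_s R = 1` again for every repulsive `v` — a rigorous version would need
`E₀` within `o(Nk²)` of a product-state energy, false for hard cores (product states have infinite
energy) and losing the correlation energy in general; recorded as heuristic only. (iv) Nothing in the
toy contradicts GDCan or the KLS chain (`√(bc) ≥ ‖ζ‖²` with slack ≤ 10%). -/

end Summit.AtomisticToContinuum.BoseEinsteinCondensation.Cruxes.GDTransfer.Disproof
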